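import Literature.NumberTheory.EllipticCurves.PastenValuationProductThm75MultiplicityProofs
import Literature.NumberTheory.Sieve.BrunPureSieve
import HarnessLib

/-!
# Pasten's Theorem 7.5 from modularity and Mazur–Kenku alone: the agreeing classes counted by
# the `q`-expansion injection and Brun's pure sieve (proofs-only sibling of
# `PastenValuationProduct.lean`; theorems only, D-0026)

Topic `NumberTheory/EllipticCurves`. The named fact
`Literature.NumberTheory.EllipticCurves.pasten_thm_7_5` (`PastenValuationProduct.lean`; H. Pasten,
*Shimura curves and the abc conjecture*, J. Number Theory 254 (2024), Thm. 7.5, proof §7.4 p. 27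
with §3 p. 13 and the asymptotic clause of Thm. 7.2, proof p. 26: for every `ε > 0` and every
elliptic curve `E/ℚ` of conductor `N ≫_ε 1`, `log |Δ_E| < (1/4 + ε) N log N`) was reduced in the
sibling `PastenValuationProductThm75MultiplicityProofs` to THREE named facts of the tree: modularity
(`exists_isNewformOf`), the Mazur–Kenku comparison (`PastenShimura2024_minimalDegree_le_163_mul`) and
Murty–Sinha's multiplicity bound for the eigenvalues of `T_ℓ` on `S₂(Γ₀(N))`
(`murtySinha2009_eigenvalue_multiplicity_weightTwo`, resting on the Eichler–Selberg trace formula).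

This file removes the last spectral input: it proves the asymptotic clause of Thm. 7.2 — indeed
`log δ_{1,N} = o(N log N)` (`Pasten2024.exists_log_modularDegree_lt`) — from theorems of the tree
only, so that

  `pasten_thm_7_5` ⟸ `exists_isNewformOf` ∧ `PastenShimura2024_minimalDegree_le_163_mul`

(`pasten_thm_7_5_of_exists_isNewformOf_mazurKenku`): the Modularity Theorem and the Mazur–Kenku /
Edixhoven comparison, both inputs of the printed §3, and nothing else.

## The argument (a deviation from the printed proof of Thm. 7.2, and why)

Pasten (proof of Thm. 7.2, p. 26) bounds every congruence modulus `η_{[χ₀]}(c)` through a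
distinguishing index `n_c ≪_ε N^{1+ε}` (Murty's Lemma 11, Rankin–Selberg theory — not in the tree).
The sibling file split the classes at ONE good prime `ℓ` and needed a bound for the multiplicity of
the eigenvalue `a_ℓ(f)` of `T_ℓ` (Murty–Sinha). Here the classes `P ≠ P_f` (minimal primes of the
anemic Hecke ring `𝕋`) are split along the SET `L` of all primes `ℓ ≤ z`, `ℓ ∤ N`:

* a class distinguished from `χ₀` at SOME `ℓ ∈ L` (`T_ℓ − a_ℓ(f) ∉ P`) costs
  `log η_P ≤ #c · log(2(z + 1))` (Prop. 5.4 with the integer polynomial of `T_ℓ` and the trivial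
  bound `|μ| ≤ ℓ + 1`, `log_heckeCongruenceModulus_le_of_not_mem_of_bound`);
* a class agreeing with `χ₀` on all of `L` costs `log η_P ≤ #c · log(2(N³ + 1))`
  (`log_heckeCongruenceModulus_le_of_bound`), and the total size of these classes is at most the
  dimension of the joint eigenspace `W = {g ∈ S₂(Γ₀(N)) : T_ℓ g = a_ℓ(f) g ∀ ℓ ∈ L}`
  (`sum_finrank_quotient_le_finrank_iInf_ker`, the joint form of the sibling's kernel count);
* **the `q`-expansion injection** (`finrank_le_card_rough_of_heckeT_eq_smul`): `g ∈ W` is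
  determined by its coefficients `a_m(g)`, `m ≤ B = μ/6 + 1`, with `m` free of primes of `L` — the
  Hecke recursion `a_{ℓ m}(g) = a_ℓ a_m(g) − ℓ a_{m/ℓ}(g)` (Diamond–Shurman Prop. 5.2.2, the tree's
  `qExpansion_coeff_heckeT_holds`) recovers the others, and Sturm's bound (the tree's
  `cuspForm_eq_zero_of_qExpansion_coeff_eq_zero`) makes `a_1, …, a_B` faithful; so
  `dim W ≤ #{m ≤ B : (m, ∏ L) = 1}`;
* **Brun's pure sieve** (the tree's `BrunPureSieve.brun_pure_sieve_Icc`, Cojocaru–Murty §6.1) and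
  Mertens' theorems (the tree's `abs_prod_one_sub_inv_mul_log_sub_one_le`, `abs_primeRecipSum_sub_le`):
  with `z = exp(u/(40 log u))`, `u = log N`, and truncation `r = 2⌈4 log u⌉`,
  `#{m ≤ B : (m, ∏L) = 1} ≤ B (∏_{ℓ ∈ L}(1 − 1/ℓ) + 2^{−(r+1)} e^{2 Σ_{ℓ ∈ L} 1/ℓ}) + (#L + 1)^r`
  `≪ N (log u)⁴/u + N/u² + √N = o(N)`
  (`B ≤ μ ≤ C₁ N log log N`, `∏_{ℓ ≤ z, ℓ ∤ N}(1 − 1/ℓ) ≤ (3/log z)(∏_{p ∣ N}(1 + 1/p))²`).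

With `Σ_{c ≠ [χ₀]} #c ≤ (13/12) N` (Prop. 7.1, `PastenEigenSystemCountProofs`) and Thm. 5.5 (a theorem
of the tree) this gives `log δ_{1,N} ≪ N log N / log log N = o(N log N)`, more than the
`(1/24 + ε) N log N` consumed by Thm. 7.5. Everything else is as in the siblings; nothing is restated.

Main results:

* `ModularForms.sum_finrank_quotient_le_finrank_iInf_ker` — `Σ_{P ∈ s} rank_ℤ(𝕋 ⧸ P) ≤ dim_ℂ ⋂_j ker t_j`
  for minimal primes `P ∋ t_j` (every weight);
* `ModularForms.finrank_le_card_rough_of_heckeT_eq_smul` — the `q`-expansion injection (every weight,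
  every finite set of primes);
* `ModularForms.card_rough_le_brun`, `ModularForms.prod_filter_not_dvd_one_sub_inv_le`,
  `ModularForms.prod_primesLE_one_sub_inv_le`, `ModularForms.primeRecipSum_le_loglog` — the sieve
  count and its Mertens-type inputs;
* `Pasten2024.log_modularDegree_le_of_primes_of_bounds`, `Pasten2024.log_modularDegree_le_of_primes_trivial`
  — congruence splitting at a set of good primes;
* `Pasten2024.exists_log_modularDegree_lt`, `Pasten2024.exists_log_modularDegree_lt'` — Thm. 7.2's
  asymptotic clause, `log δ_{1,N} < ε N log N` for `N ≫_ε 1`, unconditionally;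
  `Pasten2024.exists_log_minModularDegree_lt`, `Pasten2024.exists_log_minModularDegree_lt_of_exists_isNewformOf`
  — the same for the minimal modular degree of a globally minimal curve, from modularity and
  Mazur–Kenku;
* `pasten_thm_7_5_of_modularity_mazurKenku`, `pasten_thm_7_5_of_exists_isNewformOf_mazurKenku`,
  `pasten_thm_7_5_of_exists_isNewformOf_mazurKenku_edixhoven` — Thm. 7.5 from modularity and
  Mazur–Kenku (with Edixhoven's integrality) only;
* `exists_log_minimalDiscriminantNorm_lt_of_modularity_mazurKenku`,
  `exists_log_minimalDiscriminantNorm_lt_of_exists_isNewformOf_mazurKenku` — from the same two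
  facts, the conclusion of Thm. 7.5 sharpened to `log |Δ_E| < ε N_E log N_E` (`N_E ≫_ε 1`).

## References

* H. Pasten, *Shimura curves and the abc conjecture*, J. Number Theory 254 (2024), 214–335,
  doi:10.1016/j.jnt.2023.07.002 = arXiv:1705.09251: Prop. 5.4 and §5.4 (p. 17), Thm. 5.5 (p. 18),
  §7.1 Prop. 7.1, Thm. 7.2 and its proof (p. 26), §7.4 Thm. 7.5 (p. 27). [PastenShimura2024]
* A. C. Cojocaru, M. R. Murty, *An Introduction to Sieve Methods and their Applications*, CUP 2005,
  §6.1 (Brun's pure sieve). [CojocaruMurty2005]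
* J. Sturm, *On the congruence of modular forms*, LNM 1240 (1987), Thm. 1. [Sturm1987]
* F. Diamond, J. Shurman, *A first course in modular forms*, GTM 228, Prop. 5.2.2. [DiamondShurman2005]
* G. H. Hardy, E. M. Wright, *An Introduction to the Theory of Numbers*, Thms. 427, 429 (Mertens).
  [HardyWright2008]
-/

noncomputable section

open scoped MatrixGroups ModularForm ComplexConjugate

open CongruenceSubgroup UpperHalfPlane Polynomial

namespace Literature.NumberTheory.EllipticCurves.ModularForms

/-! ### Joint kernels of several elements of `𝕋` -/

section JointKernel

variable {N : ℕ} [NeZero N] {k : ℤ}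

/-- **The joint kernel of a family `t_j ∈ 𝕋` is spanned by the eigenbasis vectors it contains.**
[folklore] -/
theorem iInf_ker_le_span_of_eigenbasis {ι : Type*} [Fintype ι] {κ : Type*}
    (v : ι → CuspForm (Gamma0 N) k) (hv : LinearIndependent ℂ v)
    (hsp : ⊤ ≤ Submodule.span ℂ (Set.range v)) (hev : ∀ i, IsAnemicEigenvector (v i))
    (t : κ → anemicHeckeRing N k) :
    (⨅ j, LinearMap.ker (t j : Module.End ℂ (CuspForm (Gamma0 N) k))) ≤
      Submodule.span ℂ (v '' {i | ∀ j, (t j : Module.End ℂ (CuspForm (Gamma0 N) k)) (v i) = 0}) := by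
  intro x hx
  rw [Submodule.mem_iInf] at hx
  let B := Module.Basis.mk hv hsp
  have hB : ∀ i, B i = v i := fun i ↦ Module.Basis.mk_apply hv hsp i
  have hxrep : x = ∑ i, B.repr x i • v i := by
    conv_lhs => rw [← B.sum_repr x]
    simp only [hB]
  have hcoef : ∀ j i, B.repr x i * anemicEigenvalue (v i) (t j) = 0 := by
    intro j
    have hsum : ∑ i, (B.repr x i * anemicEigenvalue (v i) (t j)) • v i = 0 := by
      have h := LinearMap.mem_ker.mp (hx j)
      rw [hxrep, map_sum] at h
      rw [← h]
      refine Finset.sum_congr rfl fun i _ ↦ ?_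
      rw [map_smul, (hev i).apply_eq_smul (t j), smul_smul]
    exact Fintype.linearIndependent_iff.mp hv _ hsum
  rw [hxrep]
  refine Submodule.sum_mem _ fun i _ ↦ ?_
  by_cases hi : ∀ j, (t j : Module.End ℂ (CuspForm (Gamma0 N) k)) (v i) = 0
  · exact Submodule.smul_mem _ _ (Submodule.subset_span ⟨i, hi, rfl⟩)
  · simp only [not_forall] at hi
    obtain ⟨j, hj⟩ := hi
    have ha : anemicEigenvalue (v i) (t j) ≠ 0 := by
      intro h0
      apply hj
      rw [(hev i).apply_eq_smul (t j), h0, zero_smul]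
    rw [(mul_eq_zero.mp (hcoef j i)).resolve_right ha, zero_smul]
    exact Submodule.zero_mem _

/-- A set of eigenbasis vectors in the joint kernel of the `t_j` has at most `dim ⋂_j ker t_j`
members. [folklore] -/
theorem card_le_finrank_iInf_ker {ι : Type*} [Fintype ι] {κ : Type*}
    (v : ι → CuspForm (Gamma0 N) k) (hv : LinearIndependent ℂ v) (t : κ → anemicHeckeRing N k)
    (I : Finset ι) (hI : ∀ i ∈ I, ∀ j, (t j : Module.End ℂ (CuspForm (Gamma0 N) k)) (v i) = 0) :
    I.card ≤ Module.finrank ℂ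
      ↥(⨅ j, LinearMap.ker (t j : Module.End ℂ (CuspForm (Gamma0 N) k))) := by
  haveI := finiteDimensional_cuspForm_gamma0 (N := N) k
  set K : Submodule ℂ (CuspForm (Gamma0 N) k) :=
    ⨅ j, LinearMap.ker (t j : Module.End ℂ (CuspForm (Gamma0 N) k)) with hK
  let u : ↥I → K := fun i ↦
    ⟨v i.1, (Submodule.mem_iInf _).mpr fun j ↦ LinearMap.mem_ker.mpr (hI i.1 i.2 j)⟩
  have hu : LinearIndependent ℂ u := by
    refine LinearIndependent.of_comp K.subtype ?_
    exact hv.comp (fun i : ↥I ↦ (i.1 : ι)) fun i j h ↦ Subtype.ext h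
  have h := hu.fintype_card_le_finrank
  rwa [Fintype.card_coe] at h

/-- **An element of `𝕋` which is a non-zero integer on the joint kernel of the `t_j` and kills the
other eigenbasis vectors**: the product `g = ∏_j g_j` of the elements of `exists_int_smul_on_ker`
(`g_j = c_j` on `ker t_j`, `t_j g_j = 0`): on a vector of the joint kernel every `g_j` acts by `c_j`;
on an eigenbasis vector `v` with `t_{j₀} v ≠ 0` the factor `g_{j₀}` has eigenvalue `0`. [folklore] -/
theorem exists_int_smul_on_iInf_ker {ι : Type*} [Fintype ι] {κ : Type*} [Fintype κ]
    (v : ι → CuspForm (Gamma0 N) k) (hv : LinearIndependent ℂ v)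
    (hsp : ⊤ ≤ Submodule.span ℂ (Set.range v)) (hev : ∀ i, IsAnemicEigenvector (v i))
    (t : κ → anemicHeckeRing N k) :
    ∃ (g : anemicHeckeRing N k) (c : ℤ), c ≠ 0 ∧
      (∀ i, (∀ j, (t j : Module.End ℂ (CuspForm (Gamma0 N) k)) (v i) = 0) →
        (g : Module.End ℂ (CuspForm (Gamma0 N) k)) (v i) = (c : ℂ) • v i) ∧
      ∀ i, (¬ ∀ j, (t j : Module.End ℂ (CuspForm (Gamma0 N) k)) (v i) = 0) →
        (g : Module.End ℂ (CuspForm (Gamma0 N) k)) (v i) = 0 := by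
  classical
  have h1 : ∀ j, ∃ (g : anemicHeckeRing N k) (c : ℤ), c ≠ 0 ∧
      (∀ w, (t j : Module.End ℂ (CuspForm (Gamma0 N) k)) w = 0 →
        (g : Module.End ℂ (CuspForm (Gamma0 N) k)) w = (c : ℂ) • w) ∧
      ∀ x, (t j : Module.End ℂ (CuspForm (Gamma0 N) k))
        ((g : Module.End ℂ (CuspForm (Gamma0 N) k)) x) = 0 :=
    fun j ↦ exists_int_smul_on_ker v hv hsp hev (t j)
  choose g c hc hgker hgrange using h1
  refine ⟨∏ j, g j, ∏ j, c j, Finset.prod_ne_zero_iff.mpr fun j _ ↦ hc j, fun i hi ↦ ?_,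
    fun i hi ↦ ?_⟩
  · -- every `g j` acts by `c j` on `v i`
    have key : ∀ s : Finset κ, ((∏ j ∈ s, g j : anemicHeckeRing N k) :
        Module.End ℂ (CuspForm (Gamma0 N) k)) (v i) = ((∏ j ∈ s, c j : ℤ) : ℂ) • v i := by
      intro s
      induction s using Finset.induction_on with
      | empty => simp
      | insert j s hj ih =>
        rw [Finset.prod_insert hj, Finset.prod_insert hj, Subalgebra.coe_mul, Module.End.mul_apply,
          ih, map_smul, hgker j (v i) (hi j), smul_smul, Int.cast_mul, mul_comm]
    exact key Finset.univ
  · -- some `t j₀` does not kill `v i`; then `g j₀` does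
    simp only [not_forall] at hi
    obtain ⟨j₀, hj₀⟩ := hi
    have hv0 : v i ≠ 0 := hv.ne_zero i
    have ht0 : anemicEigenvalue (v i) (t j₀) ≠ 0 := by
      intro h0
      apply hj₀
      rw [(hev i).apply_eq_smul (t j₀), h0, zero_smul]
    have hg0 : (g j₀ : Module.End ℂ (CuspForm (Gamma0 N) k)) (v i) = 0 := by
      have h := hgrange j₀ (v i)
      rw [(hev i).apply_eq_smul (g j₀), map_smul, (hev i).apply_eq_smul (t j₀), smul_smul] at h
      have hlam : anemicEigenvalue (v i) (g j₀) = 0 := by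
        rcases smul_eq_zero.mp h with h1 | h1
        · exact (mul_eq_zero.mp h1).resolve_right ht0
        · exact absurd h1 hv0
      rw [(hev i).apply_eq_smul (g j₀), hlam, zero_smul]
    rw [← Finset.mul_prod_erase Finset.univ g (Finset.mem_univ j₀), mul_comm, Subalgebra.coe_mul,
      Module.End.mul_apply, hg0, map_zero]

/-- **`Σ_{P ∈ s} rank_ℤ(𝕋 ⧸ P) ≤ dim_ℂ ⋂_j ker t_j` for minimal primes `P` containing all the `t_j`,
over a simultaneous eigenbasis `v`** (the joint form of `sum_finrank_quotient_le_finrank_ker_of_eigenbasis`,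
same proof with `I = {i : t_j v_i = 0 ∀ j}`, the element of `exists_int_smul_on_iInf_ker` and
`iInf_ker_le_span_of_eigenbasis`). [cite: PastenShimura2024, §4.11 p. 16] -/
theorem sum_finrank_quotient_le_finrank_iInf_ker_of_eigenbasis {ι : Type*} [Fintype ι]
    {κ : Type*} [Fintype κ]
    (v : ι → CuspForm (Gamma0 N) k) (hv : LinearIndependent ℂ v)
    (hsp : ⊤ ≤ Submodule.span ℂ (Set.range v)) (hev : ∀ i, IsAnemicEigenvector (v i))
    (t : κ → anemicHeckeRing N k) (s : Finset (Ideal (anemicHeckeRing N k)))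
    (hs : ∀ P ∈ s, P ∈ minimalPrimes (anemicHeckeRing N k)) (ht : ∀ P ∈ s, ∀ j, t j ∈ P) :
    ∑ P ∈ s, Module.finrank ℤ (anemicHeckeRing N k ⧸ P) ≤
      Module.finrank ℂ ↥(⨅ j, LinearMap.ker (t j : Module.End ℂ (CuspForm (Gamma0 N) k))) := by
  classical
  set I : Finset ι := Finset.univ.filter fun i ↦
    ∀ j, (t j : Module.End ℂ (CuspForm (Gamma0 N) k)) (v i) = 0 with hI
  have hmemI : ∀ i, i ∈ I ↔ ∀ j, (t j : Module.End ℂ (CuspForm (Gamma0 N) k)) (v i) = 0 :=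
    fun i ↦ by
    rw [hI, Finset.mem_filter]
    exact ⟨fun h ↦ h.2, fun h ↦ ⟨Finset.mem_univ _, h⟩⟩
  set 𝔞 : Ideal (anemicHeckeRing N k) := I.inf fun i ↦ eigenIdeal (v i) with h𝔞_def
  have hmem𝔞 : ∀ x : anemicHeckeRing N k, x ∈ 𝔞 ↔
      ∀ i ∈ I, (x : Module.End ℂ (CuspForm (Gamma0 N) k)) (v i) = 0 := fun x ↦ by
    rw [h𝔞_def, Submodule.mem_finsetInf]
    exact forall₂_congr fun i _ ↦ mem_eigenIdeal
  -- the element `g`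
  obtain ⟨g, c, hc, hgI0, hgI'0⟩ := exists_int_smul_on_iInf_ker v hv hsp hev t
  have hgI : ∀ i ∈ I, (g : Module.End ℂ (CuspForm (Gamma0 N) k)) (v i) = (c : ℂ) • v i :=
    fun i hi ↦ hgI0 i ((hmemI i).mp hi)
  have hgI' : ∀ i, i ∉ I → (g : Module.End ℂ (CuspForm (Gamma0 N) k)) (v i) = 0 :=
    fun i hi ↦ hgI'0 i fun h ↦ hi ((hmemI i).mpr h)
  -- `𝔞 ⊆ P` for `P ∈ s`
  have h𝔞P : ∀ P ∈ s, 𝔞 ≤ P := by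
    intro P hP x hx
    obtain ⟨y, φg, hφg, hφ0, hPφ⟩ := exists_isNewform0_eigenIdeal_eq_of_mem_minimalPrimes (hs P hP)
    set φ := degeneracyMap0 y.1.1 N y.1.2 k φg with hφ
    have htφ : ∀ j, (t j : Module.End ℂ (CuspForm (Gamma0 N) k)) φ = 0 := by
      intro j
      have h := ht P hP j
      rw [hPφ] at h
      exact mem_eigenIdeal.mp h
    have hφmem : φ ∈ ⨅ j, LinearMap.ker (t j : Module.End ℂ (CuspForm (Gamma0 N) k)) :=
      (Submodule.mem_iInf _).mpr fun j ↦ LinearMap.mem_ker.mpr (htφ j)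
    have hφspan := iInf_ker_le_span_of_eigenbasis v hv hsp hev t hφmem
    rw [hPφ, mem_eigenIdeal]
    have hle : Submodule.span ℂ
        (v '' {i | ∀ j, (t j : Module.End ℂ (CuspForm (Gamma0 N) k)) (v i) = 0}) ≤
        LinearMap.ker (x : Module.End ℂ (CuspForm (Gamma0 N) k)) := by
      rw [Submodule.span_le]
      rintro _ ⟨i, hi, rfl⟩
      exact LinearMap.mem_ker.mpr (((hmem𝔞 x).mp hx) i ((hmemI i).mpr hi))
    exact LinearMap.mem_ker.mp (hle hφspan)
  calc ∑ P ∈ s, Module.finrank ℤ (anemicHeckeRing N k ⧸ P)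
      ≤ Module.finrank ℤ (anemicHeckeRing N k ⧸ 𝔞) :=
        sum_finrank_quotient_le_finrank_quotient 𝔞 s hs h𝔞P
    _ ≤ (I.image fun i ↦ anemicEigenvalue (v i)).card :=
        finrank_quotient_le_card_systems_of_int_smul v hv hsp hev I g c hc hgI hgI' _
          fun i hi ↦ Finset.mem_image_of_mem _ hi
    _ ≤ I.card := Finset.card_image_le
    _ ≤ Module.finrank ℂ ↥(⨅ j, LinearMap.ker (t j : Module.End ℂ (CuspForm (Gamma0 N) k))) :=
        card_le_finrank_iInf_ker v hv t I fun i hi ↦ (hmemI i).mp hi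

/-- **`Σ_{P ∈ s} rank_ℤ(𝕋 ⧸ P) ≤ dim_ℂ ⋂_j ker t_j`** for any finite set `s` of minimal primes of
`𝕋 = 𝕋_{1,N}` (any weight) containing all the `t_j ∈ 𝕋`: the total size `Σ #c` of the classes of
systems of Hecke eigenvalues `c` with `χ(t_j) = 0` for all `j` is at most the dimension of the joint
kernel of the `t_j` on `S_k(Γ₀(N))` (with the Atkin–Lehner eigenbasis). For `t_j = T_{ℓ_j} − a_j`
this joint kernel is the joint eigenspace of the `T_{ℓ_j}`, whose dimension the `q`-expansion
injection bounds (`finrank_le_card_rough_of_heckeT_eq_smul`). [cite: PastenShimura2024, §4.11 p. 16] -/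
theorem sum_finrank_quotient_le_finrank_iInf_ker {κ : Type*} [Fintype κ]
    (t : κ → anemicHeckeRing N k) (s : Finset (Ideal (anemicHeckeRing N k)))
    (hs : ∀ P ∈ s, P ∈ minimalPrimes (anemicHeckeRing N k)) (ht : ∀ P ∈ s, ∀ j, t j ∈ P) :
    ∑ P ∈ s, Module.finrank ℤ (anemicHeckeRing N k ⧸ P) ≤
      Module.finrank ℂ ↥(⨅ j, LinearMap.ker (t j : Module.End ℂ (CuspForm (Gamma0 N) k))) := by
  classical
  haveI := finite_atkinLehnerIndex N
  haveI : Fintype (AtkinLehnerIndex N) := Fintype.ofFinite _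
  haveI : ∀ y : {y : AtkinLehnerIndex N // y.1.2 = 1}, Fintype ↥(newforms0 y.1.1.1 k) :=
    fun y ↦ (finite_newforms0_holds y.1.1.1 k).fintype
  exact sum_finrank_quotient_le_finrank_iInf_ker_of_eigenbasis _
    (linearIndependent_degeneracyMap0_newforms N k) (span_degeneracyMap0_newforms_eq_top N k)
    (isAnemicEigenvector_degeneracyMap0_newforms N k) t s hs ht

end JointKernel

/-! ### The `q`-expansion injection: a joint eigenspace of `T_ℓ`, `ℓ ∈ L`, embeds into `ℂ^{L-rough m ≤ B}` -/

section Injection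

open ModularForm SlashInvariantForm ModularFormClass

variable (N : ℕ) [NeZero N] (k : ℤ)

/-- **The `q`-expansion injection.** Let `L` be a finite set of primes, and `W ⊆ S_k(Γ₀(N))` a
subspace on which every `T_ℓ`, `ℓ ∈ L`, acts by a scalar `a_ℓ` (`T_ℓ = U_ℓ` is allowed for
`ℓ ∣ N`). Then `dim W ≤ #{1 ≤ m ≤ B : ℓ ∤ m for all ℓ ∈ L}`, `B = ⌊k μ/12⌋ + 1`,
`μ = [SL₂(ℤ) : Γ₀(N)]`: the linear map `g ↦ (a_m(g))_{m ≤ B, m L-rough}` is injective, because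
the Hecke recursion `a_{ℓ m}(g) = a_ℓ a_m(g) − 𝟙_{ℓ ∤ N} ℓ^{k−1} a_{m/ℓ}(g)`
(`qExpansion_coeff_heckeT_holds`, Diamond–Shurman Prop. 5.2.2) recovers every `a_n(g)`, `n ≤ B`,
from the `L`-rough ones by induction on `n`, and `a_n(g) = 0` for all `n ≤ B` forces `g = 0` by the
cuspidal Sturm bound (`cuspForm_eq_zero_of_qExpansion_coeff_eq_zero`).
[cite: DiamondShurman2005, Prop. 5.2.2] [cite: Sturm1987, Thm. 1] -/
theorem finrank_le_card_rough_of_heckeT_eq_smul (L : Finset ℕ) (hL : ∀ p ∈ L, p.Prime)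
    (a : ℕ → ℂ) (W : Submodule ℂ (CuspForm (Gamma0 N) k))
    (hW : ∀ g ∈ W, ∀ (p : ℕ) (hp : p ∈ L),
      (haveI : NeZero p := ⟨(hL p hp).ne_zero⟩; heckeT (Gamma0 N) k p) g = a p • g) :
    Module.finrank ℂ W ≤
      ((Finset.Icc 1 ((k * gamma0Index N).toNat / 12 + 1)).filter
        (fun m ↦ ∀ p ∈ L, ¬ p ∣ m)).card := by
  classical
  haveI := finiteDimensional_cuspForm_gamma0 (N := N) k
  set B : ℕ := (k * gamma0Index N).toNat / 12 + 1 with hB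
  set S : Finset ℕ := (Finset.Icc 1 B).filter (fun m ↦ ∀ p ∈ L, ¬ p ∣ m) with hS
  have h1 := one_mem_strictPeriods_coe_gamma0 N
  have han : ∀ f : CuspForm (Gamma0 N) k, AnalyticAt ℂ (cuspFunction 1 f) 0 := fun f ↦
    ModularFormClass.analyticAt_cuspFunction_zero f one_pos h1
  -- the truncated rough `q`-expansion
  let Φ : W →ₗ[ℂ] (↥S → ℂ) :=
    { toFun := fun g m ↦ (qExpansion 1 ⇑(g : CuspForm (Gamma0 N) k)).coeff m.1
      map_add' := fun g g' ↦ by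
        funext m
        simp only [Pi.add_apply, Submodule.coe_add]
        rw [CuspForm.coe_add, qExpansion_add (han _) (han _), map_add]
      map_smul' := fun c g ↦ by
        funext m
        simp only [Pi.smul_apply, RingHom.id_apply, smul_eq_mul, Submodule.coe_smul]
        rw [CuspForm.IsGLPos.coe_smul, qExpansion_smul (han _), map_smul, smul_eq_mul] }
  have hΦ : Function.Injective Φ := by
    rw [injective_iff_map_eq_zero]
    intro g hg
    have hgS : ∀ m ∈ S, (qExpansion 1 ⇑(g : CuspForm (Gamma0 N) k)).coeff m = 0 :=
      fun m hm ↦ congr_fun hg ⟨m, hm⟩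
    -- all coefficients up to `B` vanish, by induction through the Hecke recursion
    have hzero : ∀ n, n ≤ B → (qExpansion 1 ⇑(g : CuspForm (Gamma0 N) k)).coeff n = 0 := by
      intro n
      induction n using Nat.strong_induction_on with
      | _ n ih =>
        intro hnB
        rcases Nat.eq_zero_or_pos n with rfl | hnpos
        · exact CuspFormClass.qExpansion_coeff_zero _ one_pos h1
        by_cases hrough : ∀ p ∈ L, ¬ p ∣ n
        · exact hgS n (by
            rw [hS, Finset.mem_filter, Finset.mem_Icc]
            exact ⟨⟨hnpos, hnB⟩, hrough⟩)
        · simp only [not_forall, not_not] at hrough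
          obtain ⟨p, hpL, hpn⟩ := hrough
          have hp := hL p hpL
          haveI : NeZero p := ⟨hp.ne_zero⟩
          obtain ⟨n', rfl⟩ := hpn
          have hn'pos : 0 < n' := Nat.pos_of_mul_pos_left hnpos
          have hn'lt : n' < p * n' := lt_mul_left hn'pos hp.one_lt
          have hrec := qExpansion_coeff_heckeT_holds N k (g : CuspForm (Gamma0 N) k) p hp n'
          rw [hW g g.2 p hpL, CuspForm.IsGLPos.coe_smul, qExpansion_smul (han _), map_smul,
            smul_eq_mul, ih n' hn'lt (hn'lt.le.trans hnB), mul_zero] at hrec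
          have hif : (if p ∣ N then (0 : ℂ) else (p : ℂ) ^ (k - 1) *
              (if p ∣ n' then (qExpansion 1 ⇑(g : CuspForm (Gamma0 N) k)).coeff (n' / p) else 0)) = 0 := by
            split_ifs with h1' h2'
            · rfl
            · rw [ih (n' / p) ((Nat.div_le_self _ _).trans_lt hn'lt)
                (((Nat.div_le_self _ _).trans hn'lt.le).trans hnB), mul_zero]
            · rw [mul_zero]
          rw [hif, add_zero] at hrec
          exact hrec.symm
    -- Sturm
    have hg0 : (g : CuspForm (Gamma0 N) k) = 0 := by
      refine cuspForm_eq_zero_of_qExpansion_coeff_eq_zero h1 (g : CuspForm (Gamma0 N) k)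
        (m := B + 1) (fun i hi ↦ hzero i (by omega)) ?_
      rw [card_quotient_subgroupOf_eq_index, index_gamma0_eq_gamma0Index_holds N, hB]
      omega
    exact Subtype.ext hg0
  calc Module.finrank ℂ W ≤ Module.finrank ℂ (↥S → ℂ) := LinearMap.finrank_le_finrank_of_injective hΦ
    _ = S.card := by rw [Module.finrank_fintype_fun_eq_card, Fintype.card_coe]

end Injection

/-! ### The sieve count: `L`-rough integers up to `B` (Brun's pure sieve) -/

section SieveCount

open Finset

/-- **Brun's pure sieve for the rough integers of the injection**: for a finite set `L` of primes,
`B ≥ 0`, `r` even and `λ > 0`,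
`#{1 ≤ m ≤ B : ℓ ∤ m ∀ ℓ ∈ L} ≤ B (∏_{ℓ ∈ L} (1 − 1/ℓ) + λ^{−(r+1)} exp(λ Σ_{ℓ ∈ L} 1/ℓ)) + (#L + 1)^r`
(the tree's `BrunPureSieve.brun_pure_sieve_Icc` on `[1, B]`, with Rankin's bound
`esymm_le_inv_pow_mul_exp` for `e_{r+1}(1/ℓ)` and `Σ_{k ≤ r} C(#L, k) ≤ (#L+1)^r`).
[cite: CojocaruMurty2005, §6.1 (6.5)] -/
theorem card_rough_le_brun (L : Finset ℕ) (hL : ∀ p ∈ L, p.Prime) (B : ℕ) {r : ℕ} (hr : Even r)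
    {lam : ℝ} (hlam : 0 < lam) :
    (((Finset.Icc 1 B).filter (fun m ↦ ∀ p ∈ L, ¬ p ∣ m)).card : ℝ) ≤
      (B : ℝ) * (∏ p ∈ L, (1 - (p : ℝ)⁻¹) +
          (lam ^ (r + 1))⁻¹ * Real.exp (lam * ∑ p ∈ L, (p : ℝ)⁻¹)) +
        ((L.card : ℝ) + 1) ^ r := by
  have h := Literature.NumberTheory.Sieve.BrunPureSieve.brun_pure_sieve_Icc L hL (a := 1) (b := B)
    le_rfl (by omega) hr
  have hB : ((B : ℝ) + 1 - (1 : ℕ)) = B := by push_cast; ring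
  rw [hB] at h
  have he := Literature.NumberTheory.Sieve.BrunPureSieve.esymm_le_inv_pow_mul_exp L
    (fun p ↦ (p : ℝ)⁻¹) (fun p _ ↦ by positivity) (r + 1) hlam
  have hc := Literature.NumberTheory.Sieve.BrunPureSieve.sum_range_choose_le_pow L.card r
  have hB0 : (0 : ℝ) ≤ B := Nat.cast_nonneg B
  calc (((Finset.Icc 1 B).filter (fun m ↦ ∀ p ∈ L, ¬ p ∣ m)).card : ℝ)
      ≤ (B : ℝ) * (∏ p ∈ L, (1 - (p : ℝ)⁻¹) + ∑ S ∈ L.powersetCard (r + 1), ∏ p ∈ S, (p : ℝ)⁻¹) +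
          ∑ k ∈ range (r + 1), ((L.card).choose k : ℝ) := h
    _ ≤ (B : ℝ) * (∏ p ∈ L, (1 - (p : ℝ)⁻¹) +
          (lam ^ (r + 1))⁻¹ * Real.exp (lam * ∑ p ∈ L, (p : ℝ)⁻¹)) + ((L.card : ℝ) + 1) ^ r := by
        gcongr


/-! ### Mertens-type inputs for the sieve main term and the Rankin bound -/

/-- **Mertens' product, upper form**: `∏_{p ≤ x} (1 − 1/p) ≤ 3/log x` for `log x ≥ 12` (the tree's
relative-error form `abs_prod_one_sub_inv_mul_log_sub_one_le`, `|∏ (1 − 1/p) · e^γ log x − 1| ≤ 24/log x`,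
with `e^γ ≥ 1`). [cite: HardyWright2008, Thm 429 (§22.8)] -/
theorem prod_primesLE_one_sub_inv_le {x : ℝ} (hx2 : 2 ≤ x) (hx : 12 ≤ Real.log x) :
    ∏ p ∈ Nat.primesLE ⌊x⌋₊, (1 - (p : ℝ)⁻¹) ≤ 3 / Real.log x := by
  have h := Literature.NumberTheory.LFunctions.Mertens.abs_prod_one_sub_inv_mul_log_sub_one_le hx2 hx
  have hlog : 0 < Real.log x := by linarith
  set P := ∏ p ∈ Nat.primesLE ⌊x⌋₊, (1 - (p : ℝ)⁻¹) with hP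
  have hP0 : 0 ≤ P := Finset.prod_nonneg fun p hp ↦ by
    have hp2 : (2 : ℝ) ≤ p := by exact_mod_cast (Nat.mem_primesLE.mp hp).2.two_le
    have : (p : ℝ)⁻¹ ≤ 1 := inv_le_one_of_one_le₀ (by linarith)
    linarith
  have hγ : 1 ≤ Real.exp Real.eulerMascheroniConstant := by
    have := Real.one_half_lt_eulerMascheroniConstant
    exact Real.one_le_exp (by linarith)
  have h24 : 24 / Real.log x ≤ 2 := by
    rw [div_le_iff₀ hlog]; linarith
  have h1 : P * (Real.exp Real.eulerMascheroniConstant * Real.log x) ≤ 3 := by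
    have := (abs_le.mp h).2; linarith
  have h2 : P * Real.log x ≤ P * (Real.exp Real.eulerMascheroniConstant * Real.log x) := by
    refine mul_le_mul_of_nonneg_left ?_ hP0
    nlinarith
  rw [le_div_iff₀ hlog]
  linarith

/-- **Mertens' second theorem, upper form**: `Σ_{p ≤ x} 1/p ≤ log log x + |M| + 8/log x` for `x ≥ 2`
(the tree's `abs_primeRecipSum_sub_le`). [cite: HardyWright2008, Thm 427 (§22.7)] -/
theorem primeRecipSum_le_loglog {x : ℝ} (hx : 2 ≤ x) :
    Literature.NumberTheory.LFunctions.Mertens.primeRecipSum x ≤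
      Real.log (Real.log x) + |Literature.NumberTheory.LFunctions.Mertens.meisselMertens| +
        8 / Real.log x := by
  have h := (abs_le.mp (Literature.NumberTheory.LFunctions.Mertens.abs_primeRecipSum_sub_le hx)).2
  have hM := le_abs_self Literature.NumberTheory.LFunctions.Mertens.meisselMertens
  linarith

/-- `1 ≤ ∏_{p ∣ N} (1 − 1/p) · (∏_{p ∣ N} (1 + 1/p))²` (termwise `(1 − x)(1 + x)² ≥ 1` for
`0 < x ≤ 1/2`). [folklore] -/
theorem one_le_prod_one_sub_inv_mul_sq (N : ℕ) :
    1 ≤ (∏ p ∈ N.primeFactors, (1 - (p : ℝ)⁻¹)) * (∏ p ∈ N.primeFactors, (1 + (p : ℝ)⁻¹)) ^ 2 := by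
  rw [← Finset.prod_pow, ← Finset.prod_mul_distrib]
  calc (1 : ℝ) = ∏ _p ∈ N.primeFactors, (1 : ℝ) := Finset.prod_const_one.symm
    _ ≤ ∏ p ∈ N.primeFactors, (1 - (p : ℝ)⁻¹) * (1 + (p : ℝ)⁻¹) ^ 2 := by
        refine Finset.prod_le_prod (fun _ _ ↦ zero_le_one) fun p hp ↦ ?_
        have hp2 : (2 : ℝ) ≤ p := by exact_mod_cast (Nat.prime_of_mem_primeFactors hp).two_le
        have hx0 : 0 < (p : ℝ)⁻¹ := by positivity
        have hx2 : (p : ℝ)⁻¹ ≤ 1 / 2 := by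
          rw [inv_eq_one_div, div_le_div_iff_of_pos_left one_pos (by linarith) two_pos]; exact hp2
        nlinarith [mul_nonneg hx0.le (show 0 ≤ 1 - (p : ℝ)⁻¹ - (p : ℝ)⁻¹ ^ 2 by nlinarith)]

/-- **The sieve main term off the level**: for `N ≥ 1`,
`∏_{p ≤ z, p ∤ N} (1 − 1/p) ≤ ∏_{p ≤ z} (1 − 1/p) · (∏_{p ∣ N} (1 + 1/p))²`
(divide out the primes of `N`: `∏_{p ≤ z, p ∣ N} (1 − 1/p) ≥ ∏_{p ∣ N} (1 − 1/p) ≥ (∏_{p ∣ N}(1 + 1/p))^{−2}`).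
[folklore] -/
theorem prod_filter_not_dvd_one_sub_inv_le {N : ℕ} (hN : N ≠ 0) (z : ℕ) :
    ∏ p ∈ (Nat.primesLE z).filter (fun p ↦ ¬ p ∣ N), (1 - (p : ℝ)⁻¹) ≤
      (∏ p ∈ Nat.primesLE z, (1 - (p : ℝ)⁻¹)) * (∏ p ∈ N.primeFactors, (1 + (p : ℝ)⁻¹)) ^ 2 := by
  classical
  have hfac : ∀ p : ℕ, p.Prime → 0 ≤ 1 - (p : ℝ)⁻¹ ∧ 1 - (p : ℝ)⁻¹ ≤ 1 := fun p hp ↦ by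
    have hp2 : (2 : ℝ) ≤ p := by exact_mod_cast hp.two_le
    have : (p : ℝ)⁻¹ ≤ 1 := inv_le_one_of_one_le₀ (by linarith)
    exact ⟨by linarith, by linarith [inv_nonneg.mpr (by linarith : (0 : ℝ) ≤ p)]⟩
  set A := ∏ p ∈ (Nat.primesLE z).filter (fun p ↦ p ∣ N), (1 - (p : ℝ)⁻¹) with hA
  set Pi := ∏ p ∈ (Nat.primesLE z).filter (fun p ↦ ¬ p ∣ N), (1 - (p : ℝ)⁻¹) with hPi
  set Q := ∏ p ∈ N.primeFactors, (1 + (p : ℝ)⁻¹) with hQ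
  set Dn := ∏ p ∈ N.primeFactors, (1 - (p : ℝ)⁻¹) with hDn
  have hsplit : A * Pi = ∏ p ∈ Nat.primesLE z, (1 - (p : ℝ)⁻¹) :=
    Finset.prod_filter_mul_prod_filter_not _ _ _
  have hsub : (Nat.primesLE z).filter (fun p ↦ p ∣ N) ⊆ N.primeFactors := fun p hp ↦ by
    rw [Finset.mem_filter, Nat.mem_primesLE] at hp
    exact Nat.mem_primeFactors.mpr ⟨hp.1.2, hp.2, hN⟩
  have hA0 : 0 ≤ A := Finset.prod_nonneg fun p hp ↦
    (hfac p (Nat.mem_primesLE.mp (Finset.mem_filter.mp hp).1).2).1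
  have hPi0 : 0 ≤ Pi := Finset.prod_nonneg fun p hp ↦
    (hfac p (Nat.mem_primesLE.mp (Finset.mem_filter.mp hp).1).2).1
  have hDA : Dn ≤ A := by
    rw [hDn, ← Finset.prod_sdiff hsub]
    refine mul_le_of_le_one_left hA0 (Finset.prod_le_one (fun p hp ↦ ?_) fun p hp ↦ ?_)
    · exact (hfac p (Nat.prime_of_mem_primeFactors (Finset.mem_sdiff.mp hp).1)).1
    · exact (hfac p (Nat.prime_of_mem_primeFactors (Finset.mem_sdiff.mp hp).1)).2
  have hDQ : 1 ≤ Dn * Q ^ 2 := one_le_prod_one_sub_inv_mul_sq N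
  have hQ2 : 0 ≤ Q ^ 2 := sq_nonneg Q
  calc Pi = Pi * 1 := (mul_one _).symm
    _ ≤ Pi * (Dn * Q ^ 2) := mul_le_mul_of_nonneg_left hDQ hPi0
    _ ≤ Pi * (A * Q ^ 2) := mul_le_mul_of_nonneg_left (mul_le_mul_of_nonneg_right hDA hQ2) hPi0
    _ = (A * Pi) * Q ^ 2 := by ring
    _ = _ := by rw [hsplit]

end SieveCount

end Literature.NumberTheory.EllipticCurves.ModularForms

namespace Literature.NumberTheory.EllipticCurves

open ModularForms WeierstrassCurve

namespace Pasten2024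

variable {N : ℕ} [NeZero N] {W : WeierstrassCurve ℚ}

/-! ### Congruence splitting at a SET of good primes -/

/-- **Congruence splitting at a set of good primes with general eigenvalue bounds** (the multi-prime
form of `log_modularDegree_le_of_prime_of_bounds`): for `D` of minimal degree in its class at level
`N`, a finite set `L` of primes `ℓ ∤ N`, a common bound `G_L ≥ 1` for the eigenvalues of the `T_ℓ`,
`ℓ ∈ L`, and a bound `G ≥ 1` for the eigenvalues of all `T_p`, `p ∤ N`, `p ≤ N²(1 + log N)/6`,

  `log δ_{1,N} ≤ (Σ_{P ≠ P_f} #c) · log(2 G_L) + #{1 ≤ m ≤ μ/6 + 1 : (m, ∏L) = 1} · log(2G)`.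

Proof: `log δ ≤ Σ_{P ≠ P_f} log η_P` (Thm. 5.5, a theorem of the tree); a class `P` NOT containing
some `t_ℓ = T_ℓ − a_ℓ(f)`, `ℓ ∈ L`, costs `≤ #c · log(2 G_L)`
(`log_heckeCongruenceModulus_le_of_not_mem_of_bound` at that `ℓ`); a class containing all the `t_ℓ`
costs `≤ #c · log(2G)` (`log_heckeCongruenceModulus_le_of_bound`), and the total size of these is
`Σ_{P ∋ all t_ℓ} #c ≤ dim ⋂_ℓ ker t_ℓ` (`sum_finrank_quotient_le_finrank_iInf_ker`)
`≤ #{m ≤ μ/6 + 1 : m L-rough}` (`finrank_le_card_rough_of_heckeT_eq_smul`, the joint kernel being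
the joint eigenspace `T_ℓ = a_ℓ(f)`, `ℓ ∈ L`). [cite: PastenShimura2024, Thm. 5.5 and proof of Thm. 7.2 (p. 26)] -/
theorem log_modularDegree_le_of_primes_of_bounds
    [W.IsElliptic] (D : ModularParametrizationData W N)
    (hmin : ∀ (W' : WeierstrassCurve ℚ) [W'.IsElliptic] (D' : ModularParametrizationData W' N),
      D'.f = D.f → D.modularDegree ≤ D'.modularDegree)
    (L : Finset ℕ) (hL : ∀ p ∈ L, p.Prime) (hLN : ∀ p ∈ L, ¬ p ∣ N)
    {Gy G : ℝ} (hGy1 : 1 ≤ Gy) (hG1 : 1 ≤ G)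
    (hGy : ∀ (p : ℕ) [NeZero p], p.Prime → p ∈ L →
      ∀ μ : ℂ, Module.End.HasEigenvalue (heckeT (Gamma0 N) 2 p) μ → ‖μ‖ ≤ Gy)
    (hG : ∀ (p : ℕ) [NeZero p], p.Prime → ¬ p ∣ N →
      (p : ℝ) ≤ (N : ℝ) ^ 2 * (1 + Real.log N) / 6 →
        ∀ μ : ℂ, Module.End.HasEigenvalue (heckeT (Gamma0 N) 2 p) μ → ‖μ‖ ≤ G) :
    Real.log (D.modularDegree : ℝ) ≤
      (∑ P ∈ (finite_minimalPrimes_anemicHeckeRing N 2).toFinset.erase (eigenIdeal D.f),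
          (Module.finrank ℤ (anemicHeckeRing N 2 ⧸ P) : ℝ)) * Real.log (2 * Gy) +
        ((((Finset.Icc 1 (gamma0Index N / 6 + 1)).filter (fun m ↦ ∀ p ∈ L, ¬ p ∣ m)).card : ℕ) : ℝ) *
          Real.log (2 * G) := by
  classical
  have hf := D.hasIntegralEigenvalues_f
  have hf0 := D.f_ne_zero
  have hnew : IsNewform0 D.f := D.isNewformOf.1
  set M := (finite_minimalPrimes_anemicHeckeRing N 2).toFinset with hM
  set Pf := eigenIdeal D.f with hPf
  -- the elements `t_ℓ = T_ℓ − a_ℓ(f)`, `ℓ ∈ L`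
  set t : ↥L → anemicHeckeRing N 2 := fun i ↦
    (haveI : NeZero i.1 := ⟨(hL i.1 i.2).ne_zero⟩;
      anemicHeckeRing.T N 2 i.1 (hL i.1 i.2) (hLN i.1 i.2) -
        (intEigencharacter hf hf0 (anemicHeckeRing.T N 2 i.1 (hL i.1 i.2) (hLN i.1 i.2)) :
          anemicHeckeRing N 2)) with ht_def
  have ha : ∀ i : ↥L, (haveI : NeZero i.1 := ⟨(hL i.1 i.2).ne_zero⟩;
      ((intEigencharacter hf hf0 (anemicHeckeRing.T N 2 i.1 (hL i.1 i.2) (hLN i.1 i.2)) : ℂ)) =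
        (qExpansion 1 ⇑D.f).coeff i.1) := by
    intro i
    haveI : NeZero i.1 := ⟨(hL i.1 i.2).ne_zero⟩
    rw [cast_intEigencharacter, eigencharacter_T,
      heckeEigenvalue_eq_coeff_of_isNormalized hnew.2.2 (hL i.1 i.2) (hnew.2.1 i.1 (hL i.1 i.2))]
  -- the joint kernel of the `t_ℓ` is the joint eigenspace `T_ℓ = a_ℓ(f)`
  have hker : ∀ i : ↥L, ∀ w, w ∈ LinearMap.ker (t i : Module.End ℂ (CuspForm (Gamma0 N) 2)) ↔
      (haveI : NeZero i.1 := ⟨(hL i.1 i.2).ne_zero⟩; heckeT (Gamma0 N) 2 i.1 w) =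
        (qExpansion 1 ⇑D.f).coeff i.1 • w := by
    intro i w
    haveI : NeZero i.1 := ⟨(hL i.1 i.2).ne_zero⟩
    rw [LinearMap.mem_ker, ht_def]
    simp only
    rw [Subalgebra.coe_sub, LinearMap.sub_apply, anemicHeckeRing.coe_T, sub_eq_zero, ← ha i,
      SubringClass.coe_intCast, Module.End.intCast_apply, Int.cast_smul_eq_zsmul]
  have hcℓ0 : 0 ≤ Real.log (2 * Gy) := Real.log_nonneg (by linarith)
  have hcN0 : 0 ≤ Real.log (2 * G) := Real.log_nonneg (by linarith)
  have h55 := log_modularDegree_le_sum_log_heckeCongruenceModulus PastenShimura2024_thm_5_5_holds D hmin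
  rw [← hM, ← hPf] at h55
  rw [← Finset.sum_filter_add_sum_filter_not (M.erase Pf) (fun P ↦ ∀ i, t i ∈ P)] at h55
  have hmemM : ∀ P ∈ M.erase Pf, P ∈ minimalPrimes (anemicHeckeRing N 2) ∧ P ≠ Pf := fun P hP ↦
    ⟨(finite_minimalPrimes_anemicHeckeRing N 2).mem_toFinset.mp (Finset.mem_of_mem_erase hP),
      Finset.ne_of_mem_erase hP⟩
  -- classes agreeing on all of `L`
  have hagr : ∑ P ∈ (M.erase Pf).filter (fun P ↦ ∀ i, t i ∈ P),
      Real.log (heckeCongruenceModulus D.f P : ℝ) ≤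
      (∑ P ∈ (M.erase Pf).filter (fun P ↦ ∀ i, t i ∈ P),
        (Module.finrank ℤ (anemicHeckeRing N 2 ⧸ P) : ℝ)) * Real.log (2 * G) := by
    rw [Finset.sum_mul]
    refine Finset.sum_le_sum fun P hP ↦ ?_
    obtain ⟨hPmin, hPne⟩ := hmemM P (Finset.mem_of_mem_filter P hP)
    exact log_heckeCongruenceModulus_le_of_bound D hG1 hG hPmin hPne
  -- classes distinguished at some `ℓ ∈ L`
  have hdist : ∑ P ∈ (M.erase Pf).filter (fun P ↦ ¬ ∀ i, t i ∈ P),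
      Real.log (heckeCongruenceModulus D.f P : ℝ) ≤
      (∑ P ∈ (M.erase Pf).filter (fun P ↦ ¬ ∀ i, t i ∈ P),
        (Module.finrank ℤ (anemicHeckeRing N 2 ⧸ P) : ℝ)) * Real.log (2 * Gy) := by
    rw [Finset.sum_mul]
    refine Finset.sum_le_sum fun P hP ↦ ?_
    obtain ⟨hPmin, hPne⟩ := hmemM P (Finset.mem_of_mem_filter P hP)
    have htP : ¬ ∀ i, t i ∈ P := (Finset.mem_filter.mp hP).2
    simp only [not_forall] at htP
    obtain ⟨i, hi⟩ := htP
    haveI : NeZero i.1 := ⟨(hL i.1 i.2).ne_zero⟩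
    exact log_heckeCongruenceModulus_le_of_not_mem_of_bound D (hL i.1 i.2) (hLN i.1 i.2) hGy1
      (fun μ hμ ↦ hGy i.1 (hL i.1 i.2) i.2 μ hμ) hPmin hPne hi
  -- the count of the agreeing classes: joint kernel, then the `q`-expansion injection
  have hcount : (∑ P ∈ (M.erase Pf).filter (fun P ↦ ∀ i, t i ∈ P),
      (Module.finrank ℤ (anemicHeckeRing N 2 ⧸ P) : ℝ)) ≤
      ((((Finset.Icc 1 (gamma0Index N / 6 + 1)).filter (fun m ↦ ∀ p ∈ L, ¬ p ∣ m)).card : ℕ) : ℝ) := by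
    have h1 := sum_finrank_quotient_le_finrank_iInf_ker t ((M.erase Pf).filter fun P ↦ ∀ i, t i ∈ P)
      (fun P hP ↦ (hmemM P (Finset.mem_of_mem_filter P hP)).1) (fun P hP ↦ (Finset.mem_filter.mp hP).2)
    have h2 := finrank_le_card_rough_of_heckeT_eq_smul N 2 L hL (fun p ↦ (qExpansion 1 ⇑D.f).coeff p)
      (⨅ i, LinearMap.ker (t i : Module.End ℂ (CuspForm (Gamma0 N) 2))) (fun g hg p hp ↦ by
        have h := (Submodule.mem_iInf _).mp hg ⟨p, hp⟩
        exact (hker ⟨p, hp⟩ g).mp h)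
    have hB : ((2 : ℤ) * (gamma0Index N : ℕ)).toNat / 12 + 1 = gamma0Index N / 6 + 1 := by
      rw [show ((2 : ℤ) * ((gamma0Index N : ℕ) : ℤ)) = ((2 * gamma0Index N : ℕ) : ℤ) by push_cast; ring,
        Int.toNat_natCast]
      omega
    rw [hB] at h2
    exact_mod_cast h1.trans h2
  have hcount' : (∑ P ∈ (M.erase Pf).filter (fun P ↦ ¬ ∀ i, t i ∈ P),
      (Module.finrank ℤ (anemicHeckeRing N 2 ⧸ P) : ℝ)) ≤
      ∑ P ∈ M.erase Pf, (Module.finrank ℤ (anemicHeckeRing N 2 ⧸ P) : ℝ) :=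
    Finset.sum_le_sum_of_subset_of_nonneg (Finset.filter_subset _ _) fun _ _ _ ↦ Nat.cast_nonneg _
  calc Real.log (D.modularDegree : ℝ)
      ≤ _ := h55
    _ ≤ (∑ P ∈ (M.erase Pf).filter (fun P ↦ ∀ i, t i ∈ P),
          (Module.finrank ℤ (anemicHeckeRing N 2 ⧸ P) : ℝ)) * Real.log (2 * G) +
        (∑ P ∈ (M.erase Pf).filter (fun P ↦ ¬ ∀ i, t i ∈ P),
          (Module.finrank ℤ (anemicHeckeRing N 2 ⧸ P) : ℝ)) * Real.log (2 * Gy) :=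
        add_le_add hagr hdist
    _ ≤ ((((Finset.Icc 1 (gamma0Index N / 6 + 1)).filter (fun m ↦ ∀ p ∈ L, ¬ p ∣ m)).card : ℕ) : ℝ) *
          Real.log (2 * G) +
        (∑ P ∈ M.erase Pf, (Module.finrank ℤ (anemicHeckeRing N 2 ⧸ P) : ℝ)) * Real.log (2 * Gy) :=
        add_le_add (mul_le_mul_of_nonneg_right hcount hcN0) (mul_le_mul_of_nonneg_right hcount' hcℓ0)
    _ = _ := by rw [add_comm]

/-- **Congruence splitting at a set of good primes with the TRIVIAL eigenvalue bounds**: if every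
`ℓ ∈ L` is a prime `ℓ ∤ N` with `ℓ ≤ y` (`y ≥ 1`), then for `D` of minimal degree in its class at
level `N ≥ 2`,

  `log δ_{1,N} ≤ (Σ_{P ≠ P_f} #c) · log(2(y + 1)) + #{1 ≤ m ≤ μ/6 + 1 : (m, ∏L) = 1} · log(2(N³ + 1))`,

by `log_modularDegree_le_of_primes_of_bounds` with `|μ| ≤ p + 1` for the eigenvalues of `T_p`,
`p ∤ N` (`norm_eigenvalue_heckeT_gamma0_two_le`, the Petersson operator-norm bound — no Deligne, no
trace formula) and `p ≤ N²(1 + log N)/6 ≤ N³`. [cite: PastenShimura2024, Thm. 5.5 and proof of Thm. 7.2 (p. 26)] -/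
theorem log_modularDegree_le_of_primes_trivial
    [W.IsElliptic] (D : ModularParametrizationData W N)
    (hmin : ∀ (W' : WeierstrassCurve ℚ) [W'.IsElliptic] (D' : ModularParametrizationData W' N),
      D'.f = D.f → D.modularDegree ≤ D'.modularDegree)
    (hN : 2 ≤ N) (L : Finset ℕ) (hL : ∀ p ∈ L, p.Prime) (hLN : ∀ p ∈ L, ¬ p ∣ N)
    {y : ℝ} (hy : 1 ≤ y) (hLy : ∀ p ∈ L, (p : ℝ) ≤ y) :
    Real.log (D.modularDegree : ℝ) ≤
      (∑ P ∈ (finite_minimalPrimes_anemicHeckeRing N 2).toFinset.erase (eigenIdeal D.f),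
          (Module.finrank ℤ (anemicHeckeRing N 2 ⧸ P) : ℝ)) * Real.log (2 * (y + 1)) +
        ((((Finset.Icc 1 (gamma0Index N / 6 + 1)).filter (fun m ↦ ∀ p ∈ L, ¬ p ∣ m)).card : ℕ) : ℝ) *
          Real.log (2 * ((N : ℝ) ^ 3 + 1)) := by
  have hNr : (2 : ℝ) ≤ N := by exact_mod_cast hN
  refine log_modularDegree_le_of_primes_of_bounds D hmin L hL hLN (by linarith)
    (le_add_of_nonneg_left (by positivity))
    (fun p _ hp hpL μ hμ ↦ ?_) (fun p _ hp hpN hple μ hμ ↦ ?_)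
  · exact (ModularForms.norm_eigenvalue_heckeT_gamma0_two_le N p hp (hLN p hpL) hμ).trans
      (by linarith [hLy p hpL])
  · refine (ModularForms.norm_eigenvalue_heckeT_gamma0_two_le N p hp hpN hμ).trans ?_
    have hlogN : Real.log N ≤ N := (Real.log_le_sub_one_of_pos (by linarith)).trans (by linarith)
    have hpN3 : (p : ℝ) ≤ (N : ℝ) ^ 3 := by
      refine hple.trans ?_
      rw [div_le_iff₀ (by norm_num : (0:ℝ) < 6)]
      nlinarith [sq_nonneg (N : ℝ)]
    linarith

/-! ### Thm. 7.2, asymptotic clause — indeed `log δ_{1,N} ≪ N log N / log log N` — unconditionally in the spectral inputs -/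

open Filter Asymptotics in
/-- The thresholds of the endgame, all eventually true in `u = log N`. [folklore] -/
private theorem eventually_sieve_conditions (K₁ K₂ : ℝ) {ε : ℝ} (hε : 0 < ε) :
    ∃ u₀ : ℝ, ∀ u : ℝ, u₀ ≤ u →
      3 ≤ u ∧ 480 * Real.log u ≤ u ∧ 2 * Real.log (24 / ε) ≤ u ∧
        K₁ * Real.log u ^ 4 ≤ ε / 24 * u ∧ K₂ ≤ ε / 24 * u ^ 2 ∧
          Real.log 4 ≤ ε / 12 * u ∧ 13 / (60 * ε) ≤ Real.log u := by
  have c8 : ∀ᶠ u : ℝ in atTop, 3 ≤ u := eventually_ge_atTop 3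
  have c1 : ∀ᶠ u : ℝ in atTop, 480 * Real.log u ≤ u := by
    have h := (Real.isLittleO_log_id_atTop.const_mul_left (480 : ℝ)).def one_pos
    filter_upwards [h, eventually_ge_atTop (1 : ℝ)] with u hu hu1
    rw [one_mul, id, Real.norm_eq_abs, Real.norm_eq_abs, abs_of_nonneg (by linarith : (0 : ℝ) ≤ u)] at hu
    exact (le_abs_self _).trans hu
  have c3 : ∀ᶠ u : ℝ in atTop, 2 * Real.log (24 / ε) ≤ u := eventually_ge_atTop _
  have c4 : ∀ᶠ u : ℝ in atTop, K₁ * Real.log u ^ 4 ≤ ε / 24 * u := by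
    have h := ((Real.isLittleO_pow_log_id_atTop (n := 4)).const_mul_left K₁).def
      (show (0 : ℝ) < ε / 24 by positivity)
    filter_upwards [h, eventually_ge_atTop (0 : ℝ)] with u hu hu0
    rw [id, Real.norm_eq_abs, Real.norm_eq_abs, abs_of_nonneg hu0] at hu
    exact (le_abs_self _).trans hu
  have c5 : ∀ᶠ u : ℝ in atTop, K₂ ≤ ε / 24 * u ^ 2 :=
    ((tendsto_pow_atTop two_ne_zero).const_mul_atTop (show (0 : ℝ) < ε / 24 by positivity)).eventually_ge_atTop _
  have c6 : ∀ᶠ u : ℝ in atTop, Real.log 4 ≤ ε / 12 * u :=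
    (tendsto_id.const_mul_atTop (show (0 : ℝ) < ε / 12 by positivity)).eventually_ge_atTop _
  have c7 : ∀ᶠ u : ℝ in atTop, 13 / (60 * ε) ≤ Real.log u :=
    Real.tendsto_log_atTop.eventually_ge_atTop _
  obtain ⟨u₀, h⟩ := Filter.eventually_atTop.mp (c8.and (c1.and (c3.and (c4.and (c5.and (c6.and c7))))))
  exact ⟨u₀, h⟩

set_option maxHeartbeats 1600000 in
/-- **Thm. 7.2, asymptotic clause (`D = 1`, `M = N`) — indeed `log δ_{1,N} = o(N log N)` — with NO
multiplicity, trace-formula or Rankin–Selberg input.** For every `ε > 0` there is `N₁` such that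
`log δ_{1,N} < ε N log N` for every datum `D` of minimal degree in its class at level `N ≥ N₁`.

Proof (`u = log N`): apply `log_modularDegree_le_of_primes_trivial` with `L` = the primes `ℓ ≤ z`,
`ℓ ∤ N`, `z = exp(u / (40 log u))`. The distinguished classes cost
`(Σ #c) log(2(z+1)) ≤ (13/12) N (log 4 + u/(40 log u)) = o(N u)` (Prop. 7.1,
`exists_sum_erase_finrank_quotient_le`). The agreeing classes cost `m · log(2(N³+1)) ≤ 4 m u` where,
by the `q`-expansion injection and Brun's pure sieve (`card_rough_le_brun` with `r = 2⌈4 log u⌉`,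
`λ = 2`), `m ≤ B (Π + 2^{−(r+1)} e^{2Σ}) + (#L+1)^r` with `B = μ/6 + 1 ≤ C₁ N log u`
(`exists_prod_primeFactors_one_add_inv_le`), `Π = ∏_{ℓ ∈ L}(1 − 1/ℓ) ≤ (3/log z)(C₁ log u)²`
(Mertens' product `prod_primesLE_one_sub_inv_le` and `prod_filter_not_dvd_one_sub_inv_le`),
`Σ = Σ_{ℓ ∈ L} 1/ℓ ≤ log u + |M| + 1` (Mertens `primeRecipSum_le_loglog`), so that
`m ≤ 120 C₁³ N (log u)⁴/u + C₁ e^{2|M|+2} N/u² + e^{u/2} ≤ (ε/8) N` for `u ≫_ε 1`; in all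
`log δ_{1,N} ≤ (3ε/4) N u < ε N log N`. (In fact the argument gives
`log δ_{1,N} ≪ N log N / log log N`; the printed Thm. 7.2 has `(1/24 + ε) N log N` from Murty's
Lemma 11.) [cite: PastenShimura2024, Thm. 7.2 (asymptotic clause) and its proof, p. 26]
[cite: CojocaruMurty2005, §6.1 (6.5)] [cite: Sturm1987, Thm. 1] -/
theorem exists_log_modularDegree_lt {ε : ℝ} (hε : 0 < ε) :
    ∃ N₁ : ℕ, ∀ (N : ℕ) [NeZero N] (W : WeierstrassCurve ℚ) [W.IsElliptic]
      (D : ModularParametrizationData W N),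
      (∀ (W' : WeierstrassCurve ℚ) [W'.IsElliptic] (D' : ModularParametrizationData W' N),
          D'.f = D.f → D.modularDegree ≤ D'.modularDegree) →
        N₁ ≤ N → Real.log (D.modularDegree : ℝ) < ε * (N : ℝ) * Real.log N := by
  classical
  obtain ⟨C₁, hC₁pos, hC₁⟩ := exists_prod_primeFactors_one_add_inv_le
  have hC₁0 : 0 ≤ C₁ := hC₁pos.le
  obtain ⟨N₂, hN₂⟩ := exists_sum_erase_finrank_quotient_le (κ := 1) one_pos
  set Mc : ℝ := |Literature.NumberTheory.LFunctions.Mertens.meisselMertens| + 1 with hMc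
  have hMc0 : 0 ≤ Mc := by positivity
  set K₁ : ℝ := 120 * C₁ ^ 3 with hK₁
  set K₂ : ℝ := C₁ * Real.exp (2 * Mc) with hK₂
  obtain ⟨u₀, hu₀⟩ := eventually_sieve_conditions K₁ K₂ hε
  refine ⟨max N₂ (max 16 (Nat.ceil (Real.exp u₀))), fun N _ W _ D hmin hN ↦ ?_⟩
  have hN₂N : N₂ ≤ N := le_trans (le_max_left _ _) hN
  have hN16 : 16 ≤ N := le_trans ((le_max_left _ _).trans (le_max_right _ _)) hN
  have hNexp : (Nat.ceil (Real.exp u₀) : ℝ) ≤ N := by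
    exact_mod_cast le_trans ((le_max_right _ _).trans (le_max_right _ _)) hN
  have hN0 : N ≠ 0 := by omega
  have hN2 : 2 ≤ N := by omega
  have hNr : (16 : ℝ) ≤ N := by exact_mod_cast hN16
  have hNpos : (0 : ℝ) < N := by linarith
  set u : ℝ := Real.log N with hu
  have hu0 : u₀ ≤ u := by
    rw [hu, Real.le_log_iff_exp_le hNpos]
    exact (Nat.le_ceil _).trans hNexp
  obtain ⟨hu3, hc1, hc3, hc4, hc5, hc6, hc7⟩ := hu₀ u hu0
  have hupos : 0 < u := by linarith
  have hlogu1 : 1 ≤ Real.log u := by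
    rw [Real.le_log_iff_exp_le hupos]
    have := Real.exp_one_lt_d9
    linarith
  have hlogu0 : 0 < Real.log u := by linarith
  have hlogu_le : Real.log u ≤ u := (Real.log_le_sub_one_of_pos hupos).trans (by linarith)
  have hexpu : Real.exp u = N := by rw [hu, Real.exp_log hNpos]
  -- the sifting bound `z`
  set zr : ℝ := Real.exp (u / (40 * Real.log u)) with hzr
  have hzrpos : 0 < zr := Real.exp_pos _
  have hlogzr : Real.log zr = u / (40 * Real.log u) := Real.log_exp _
  have hlogzr12 : 12 ≤ Real.log zr := by
    rw [hlogzr, le_div_iff₀ (by positivity)]; linarith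
  have hu40 : u * 1 ≤ u * (40 * Real.log u) :=
    mul_le_mul_of_nonneg_left (by linarith) hupos.le
  have hlogzr_le : Real.log zr ≤ u := by
    rw [hlogzr, div_le_iff₀ (by positivity)]; linarith
  have hzr2 : 2 ≤ zr := by
    have h := Real.add_one_le_exp (Real.log zr)
    rw [Real.exp_log hzrpos] at h; linarith
  have hzr1 : 1 ≤ zr := by linarith
  have hzrN : zr ≤ N := by
    rw [← hexpu, hzr]
    exact Real.exp_le_exp.mpr (by rw [div_le_iff₀ (by positivity)]; linarith)
  set z : ℕ := ⌊zr⌋₊ with hz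
  have hzle : (z : ℝ) ≤ zr := Nat.floor_le hzrpos.le
  set L : Finset ℕ := (Nat.primesLE z).filter (fun p ↦ ¬ p ∣ N) with hL_def
  have hL : ∀ p ∈ L, p.Prime := fun p hp ↦ (Nat.mem_primesLE.mp (Finset.mem_filter.mp hp).1).2
  have hLN : ∀ p ∈ L, ¬ p ∣ N := fun p hp ↦ (Finset.mem_filter.mp hp).2
  have hLy : ∀ p ∈ L, (p : ℝ) ≤ zr := fun p hp ↦ by
    have h := (Nat.mem_primesLE.mp (Finset.mem_filter.mp hp).1).1
    exact le_trans (by exact_mod_cast h) hzle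
  -- the main inequality
  have hmain := log_modularDegree_le_of_primes_trivial D hmin hN2 L hL hLN hzr1 hLy
  -- (i) the count of classes, and the logarithmic factor of the distinguished classes
  have hS := hN₂ N W D hN₂N
  have hS0 : 0 ≤ ∑ P ∈ (finite_minimalPrimes_anemicHeckeRing N 2).toFinset.erase (eigenIdeal D.f),
      (Module.finrank ℤ (anemicHeckeRing N 2 ⧸ P) : ℝ) := Finset.sum_nonneg fun _ _ ↦ Nat.cast_nonneg _
  have hlogz : Real.log (2 * (zr + 1)) ≤ Real.log 4 + u / (40 * Real.log u) := by
    rw [← hlogzr, ← Real.log_mul (by norm_num) hzrpos.ne']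
    exact Real.log_le_log (by linarith) (by linarith)
  have hterm1 : (∑ P ∈ (finite_minimalPrimes_anemicHeckeRing N 2).toFinset.erase (eigenIdeal D.f),
      (Module.finrank ℤ (anemicHeckeRing N 2 ⧸ P) : ℝ)) * Real.log (2 * (zr + 1)) ≤ ε / 4 * N * u := by
    have hlog4 : 0 ≤ Real.log 4 := Real.log_nonneg (by norm_num)
    have hεu : 0 < ε * u := mul_pos hε hupos
    have h1 : (13 / 12 : ℝ) * Real.log 4 ≤ ε / 8 * u := by linarith
    have h2 : (13 / 12 : ℝ) * (u / (40 * Real.log u)) ≤ ε / 8 * u := by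
      rw [mul_div_assoc', div_le_iff₀ (by positivity)]
      have h := hc7
      rw [div_le_iff₀ (by positivity)] at h
      have h' := mul_le_mul_of_nonneg_left h (show (0 : ℝ) ≤ u / 12 by positivity)
      linarith
    calc _ ≤ ((1 / 12 + 1) * N) * (Real.log 4 + u / (40 * Real.log u)) :=
          mul_le_mul hS hlogz (Real.log_nonneg (by linarith)) (by positivity)
      _ = N * ((13 / 12) * Real.log 4 + (13 / 12) * (u / (40 * Real.log u))) := by ring
      _ ≤ N * (ε / 8 * u + ε / 8 * u) := mul_le_mul_of_nonneg_left (add_le_add h1 h2) hNpos.le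
      _ = ε / 4 * N * u := by ring
  -- (ii) the count of the agreeing classes: `m ≤ B (Π + E) + (#L + 1)^r`
  set r : ℕ := 2 * Nat.ceil (4 * Real.log u) with hr_def
  have hr : Even r := even_two_mul _
  have hbrun := card_rough_le_brun L hL (gamma0Index N / 6 + 1) hr two_pos
  -- `B ≤ C₁ N log u`
  have hψ : (gamma0Index N : ℝ) ≤ C₁ * N * Real.log u := by
    rw [gamma0Index_eq_mul_prod_one_add_inv_real N]
    have h := hC₁ N hN16
    rw [← hu] at h
    nlinarith [mul_le_mul_of_nonneg_left h hNpos.le]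
  have hψN : (N : ℝ) ≤ gamma0Index N := by
    rw [gamma0Index_eq_mul_prod_one_add_inv_real N]
    have h1 : (1 : ℝ) ≤ ∏ p ∈ N.primeFactors, (1 + (p : ℝ)⁻¹) :=
      Finset.prod_induction _ (fun x : ℝ ↦ 1 ≤ x)
        (fun a b ha hb ↦ one_le_mul_of_one_le_of_one_le ha hb) le_rfl
        (fun p _ ↦ le_add_of_nonneg_right (by positivity))
    nlinarith
  have hB : (((gamma0Index N / 6 + 1 : ℕ) : ℕ) : ℝ) ≤ C₁ * N * Real.log u := by
    have h1 : (((gamma0Index N / 6 + 1 : ℕ) : ℕ) : ℝ) ≤ (gamma0Index N : ℝ) / 6 + 1 := by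
      push_cast
      exact add_le_add (Nat.cast_div_le) le_rfl
    have h2 : (gamma0Index N : ℝ) / 6 + 1 ≤ gamma0Index N := by linarith
    exact h1.trans (h2.trans hψ)
  have hB0 : (0 : ℝ) ≤ (((gamma0Index N / 6 + 1 : ℕ) : ℕ) : ℝ) := Nat.cast_nonneg _
  -- `Π ≤ (3 / log z) (C₁ log u)²`
  have hQ : ∏ p ∈ N.primeFactors, (1 + (p : ℝ)⁻¹) ≤ C₁ * Real.log u := by
    have h := hC₁ N hN16; rwa [← hu] at h
  have hQ0 : 0 ≤ ∏ p ∈ N.primeFactors, (1 + (p : ℝ)⁻¹) := Finset.prod_nonneg fun _ _ ↦ by positivity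
  have hPz := prod_primesLE_one_sub_inv_le hzr2 hlogzr12
  have hPz0 : 0 ≤ ∏ p ∈ Nat.primesLE ⌊zr⌋₊, (1 - (p : ℝ)⁻¹) := Finset.prod_nonneg fun p hp ↦ by
    have hp2 : (2 : ℝ) ≤ p := by exact_mod_cast (Nat.mem_primesLE.mp hp).2.two_le
    have : (p : ℝ)⁻¹ ≤ 1 := inv_le_one_of_one_le₀ (by linarith)
    linarith
  have hPi : ∏ p ∈ L, (1 - (p : ℝ)⁻¹) ≤ 120 * C₁ ^ 2 * Real.log u ^ 3 / u := by
    have h1 := prod_filter_not_dvd_one_sub_inv_le hN0 z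
    rw [← hL_def] at h1
    have h2 : (∏ p ∈ Nat.primesLE z, (1 - (p : ℝ)⁻¹)) * (∏ p ∈ N.primeFactors, (1 + (p : ℝ)⁻¹)) ^ 2 ≤
        (3 / Real.log zr) * (C₁ * Real.log u) ^ 2 :=
      mul_le_mul hPz (pow_le_pow_left₀ hQ0 hQ 2) (sq_nonneg _) (by positivity)
    have h3 : (3 / Real.log zr) * (C₁ * Real.log u) ^ 2 = 120 * C₁ ^ 2 * Real.log u ^ 3 / u := by
      rw [hlogzr]; field_simp; ring
    linarith
  -- `E ≤ e^{2 Mc} / u³`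
  have hSum : ∑ p ∈ L, (p : ℝ)⁻¹ ≤ Real.log u + Mc := by
    have h1 : ∑ p ∈ L, (p : ℝ)⁻¹ ≤ Literature.NumberTheory.LFunctions.Mertens.primeRecipSum zr := by
      unfold Literature.NumberTheory.LFunctions.Mertens.primeRecipSum
      rw [← hz]
      exact Finset.sum_le_sum_of_subset_of_nonneg (Finset.filter_subset _ _) fun _ _ _ ↦ by positivity
    have h2 := primeRecipSum_le_loglog hzr2
    have h3 : Real.log (Real.log zr) ≤ Real.log u := Real.log_le_log (by linarith) hlogzr_le
    have h4 : 8 / Real.log zr ≤ 1 := by rw [div_le_iff₀ (by linarith)]; linarith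
    linarith
  have hE : ((2 : ℝ) ^ (r + 1))⁻¹ * Real.exp (2 * ∑ p ∈ L, (p : ℝ)⁻¹) ≤ Real.exp (2 * Mc) / u ^ 3 := by
    -- `2^{r+1} ≥ u⁵` since `r + 1 ≥ 8 log u` and `8 log 2 ≥ 5`
    have hlog2 := Real.log_two_gt_d9
    have hr8 : 8 * Real.log u ≤ (r : ℝ) + 1 := by
      have h := Nat.le_ceil (4 * Real.log u)
      rw [hr_def]; push_cast; linarith
    have hpow : u ^ 5 ≤ (2 : ℝ) ^ (r + 1) := by
      have h1 : u ^ 5 = Real.exp (((5 : ℕ) : ℝ) * Real.log u) := by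
        rw [Real.exp_nat_mul, Real.exp_log hupos]
      have h2 : (2 : ℝ) ^ (r + 1) = Real.exp (((r + 1 : ℕ) : ℝ) * Real.log 2) := by
        rw [Real.exp_nat_mul, Real.exp_log two_pos]
      rw [h1, h2, Real.exp_le_exp]
      push_cast
      linarith [mul_le_mul_of_nonneg_right hr8 (show (0 : ℝ) ≤ Real.log 2 by linarith),
        mul_nonneg hlogu0.le (show (0 : ℝ) ≤ 8 * Real.log 2 - 5 by linarith)]
    have i1 : ((2 : ℝ) ^ (r + 1))⁻¹ ≤ (u ^ 5)⁻¹ := inv_anti₀ (pow_pos hupos 5) hpow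
    have i2 : Real.exp (2 * ∑ p ∈ L, (p : ℝ)⁻¹) ≤ Real.exp (2 * (Real.log u + Mc)) :=
      Real.exp_le_exp.mpr (by linarith)
    have i3 : Real.exp (2 * (Real.log u + Mc)) = u ^ 2 * Real.exp (2 * Mc) := by
      rw [mul_add, Real.exp_add, show (2 : ℝ) * Real.log u = ((2 : ℕ) : ℝ) * Real.log u by norm_num,
        Real.exp_nat_mul, Real.exp_log hupos]
    calc ((2 : ℝ) ^ (r + 1))⁻¹ * Real.exp (2 * ∑ p ∈ L, (p : ℝ)⁻¹)
        ≤ (u ^ 5)⁻¹ * (u ^ 2 * Real.exp (2 * Mc)) :=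
          mul_le_mul i1 (i2.trans_eq i3) (Real.exp_pos _).le (by positivity)
      _ = Real.exp (2 * Mc) / u ^ 3 := by field_simp
  -- `(#L + 1)^r ≤ e^{u/2} ≤ (ε/24) N`
  have hR : ((L.card : ℝ) + 1) ^ r ≤ ε / 24 * N := by
    have hcard : (L.card : ℝ) + 1 ≤ 2 * zr := by
      have h1 : L.card ≤ z + 1 := by
        calc L.card ≤ (Nat.primesLE z).card := Finset.card_filter_le _ _
          _ ≤ (Finset.range (z + 1)).card := by
              rw [Nat.primesLE_eq_filter_range]; exact Finset.card_filter_le _ _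
          _ = z + 1 := Finset.card_range _
      have h2 : (L.card : ℝ) ≤ z + 1 := by exact_mod_cast h1
      linarith
    have hr10 : (r : ℝ) ≤ 10 * Real.log u := by
      have h := Nat.ceil_lt_add_one (show 0 ≤ 4 * Real.log u by positivity)
      rw [hr_def]; push_cast; linarith
    have h2zr : (0 : ℝ) < 2 * zr := by linarith
    have hlog2zr : Real.log (2 * zr) = Real.log 2 + u / (40 * Real.log u) := by
      rw [Real.log_mul two_ne_zero hzrpos.ne', hlogzr]
    have hlog2 := Real.log_two_lt_d9
    have hlog2pos : 0 < Real.log 2 := by have := Real.log_two_gt_d9; linarith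
    have hexp_bound : (r : ℝ) * Real.log (2 * zr) ≤ u / 2 := by
      rw [hlog2zr]
      have h1 : (r : ℝ) * (Real.log 2 + u / (40 * Real.log u)) ≤
          10 * Real.log u * (Real.log 2 + u / (40 * Real.log u)) :=
        mul_le_mul_of_nonneg_right hr10 (by positivity)
      have h2 : 10 * Real.log u * (Real.log 2 + u / (40 * Real.log u)) =
          10 * Real.log 2 * Real.log u + u / 4 := by
        field_simp
        ring
      linarith [mul_le_mul_of_nonneg_right (show 10 * Real.log 2 ≤ 7 by linarith) hlogu0.le]
    have h24 : (24 : ℝ) / ε ≤ Real.exp (u / 2) :=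
      (Real.log_le_iff_le_exp (by positivity)).mp (by linarith)
    have hhalf : Real.exp (u / 2) * Real.exp (u / 2) = N := by
      rw [← Real.exp_add, add_halves, hexpu]
    have hε24 : 0 < ε / 24 := by positivity
    calc ((L.card : ℝ) + 1) ^ r ≤ (2 * zr) ^ r := pow_le_pow_left₀ (by positivity) hcard r
      _ = Real.exp ((r : ℝ) * Real.log (2 * zr)) := by rw [Real.exp_nat_mul, Real.exp_log h2zr]
      _ ≤ Real.exp (u / 2) := Real.exp_le_exp.mpr hexp_bound
      _ = ε / 24 * (24 / ε * Real.exp (u / 2)) := by field_simp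
      _ ≤ ε / 24 * (Real.exp (u / 2) * Real.exp (u / 2)) :=
          mul_le_mul_of_nonneg_left (mul_le_mul_of_nonneg_right h24 (Real.exp_pos _).le) hε24.le
      _ = ε / 24 * N := by rw [hhalf]
  -- the count of the agreeing classes is `≤ (ε/8) N`
  have hPi0 : 0 ≤ ∏ p ∈ L, (1 - (p : ℝ)⁻¹) := Finset.prod_nonneg fun p hp ↦ by
    have hp2 : (2 : ℝ) ≤ p := by exact_mod_cast (hL p hp).two_le
    have : (p : ℝ)⁻¹ ≤ 1 := inv_le_one_of_one_le₀ (by linarith)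
    linarith
  have hcount : ((((Finset.Icc 1 (gamma0Index N / 6 + 1)).filter
      (fun m ↦ ∀ p ∈ L, ¬ p ∣ m)).card : ℕ) : ℝ) ≤ ε / 8 * N := by
    have h1 : (((gamma0Index N / 6 + 1 : ℕ) : ℕ) : ℝ) * (∏ p ∈ L, (1 - (p : ℝ)⁻¹)) ≤ ε / 24 * N := by
      have hc4' : K₁ * Real.log u ^ 4 / u ≤ ε / 24 := by rwa [div_le_iff₀ hupos]
      calc (((gamma0Index N / 6 + 1 : ℕ) : ℕ) : ℝ) * (∏ p ∈ L, (1 - (p : ℝ)⁻¹))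
          ≤ (C₁ * N * Real.log u) * (120 * C₁ ^ 2 * Real.log u ^ 3 / u) :=
            mul_le_mul hB hPi hPi0 (by positivity)
        _ = N * (K₁ * Real.log u ^ 4 / u) := by rw [hK₁]; field_simp
        _ ≤ N * (ε / 24) := mul_le_mul_of_nonneg_left hc4' hNpos.le
        _ = ε / 24 * N := by ring
    have h2 : (((gamma0Index N / 6 + 1 : ℕ) : ℕ) : ℝ) *
        (((2 : ℝ) ^ (r + 1))⁻¹ * Real.exp (2 * ∑ p ∈ L, (p : ℝ)⁻¹)) ≤ ε / 24 * N := by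
      have hc5' : K₂ / u ^ 2 ≤ ε / 24 := by rw [div_le_iff₀ (by positivity)]; exact hc5
      have hu0' : u ≠ 0 := hupos.ne'
      calc (((gamma0Index N / 6 + 1 : ℕ) : ℕ) : ℝ) *
            (((2 : ℝ) ^ (r + 1))⁻¹ * Real.exp (2 * ∑ p ∈ L, (p : ℝ)⁻¹))
          ≤ (C₁ * N * Real.log u) * (Real.exp (2 * Mc) / u ^ 3) :=
            mul_le_mul hB hE (by positivity) (by positivity)
        _ ≤ (C₁ * N * u) * (Real.exp (2 * Mc) / u ^ 3) := by gcongr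
        _ = N * (K₂ / u ^ 2) := by rw [hK₂]; field_simp
        _ ≤ N * (ε / 24) := mul_le_mul_of_nonneg_left hc5' hNpos.le
        _ = ε / 24 * N := by ring
    calc ((((Finset.Icc 1 (gamma0Index N / 6 + 1)).filter (fun m ↦ ∀ p ∈ L, ¬ p ∣ m)).card : ℕ) : ℝ)
        ≤ _ := hbrun
      _ = (((gamma0Index N / 6 + 1 : ℕ) : ℕ) : ℝ) * (∏ p ∈ L, (1 - (p : ℝ)⁻¹)) +
            (((gamma0Index N / 6 + 1 : ℕ) : ℕ) : ℝ) *
              (((2 : ℝ) ^ (r + 1))⁻¹ * Real.exp (2 * ∑ p ∈ L, (p : ℝ)⁻¹)) +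
            ((L.card : ℝ) + 1) ^ r := by ring
      _ ≤ ε / 24 * N + ε / 24 * N + ε / 24 * N := add_le_add (add_le_add h1 h2) hR
      _ = ε / 8 * N := by ring
  -- the logarithmic factor of the agreeing classes
  have hlogG : Real.log (2 * ((N : ℝ) ^ 3 + 1)) ≤ 4 * u := by
    have h1 : 2 * ((N : ℝ) ^ 3 + 1) ≤ (N : ℝ) ^ 4 := by
      have h4 : (N : ℝ) ^ 4 = N * N ^ 3 := by ring
      have h3 : (1 : ℝ) ≤ (N : ℝ) ^ 3 := one_le_pow₀ (by linarith)
      have h5 := mul_le_mul_of_nonneg_right hNr (show (0 : ℝ) ≤ (N : ℝ) ^ 3 by positivity)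
      linarith
    calc Real.log (2 * ((N : ℝ) ^ 3 + 1)) ≤ Real.log ((N : ℝ) ^ 4) := Real.log_le_log (by positivity) h1
      _ = 4 * u := by rw [Real.log_pow, hu]; norm_num
  have hterm2 : ((((Finset.Icc 1 (gamma0Index N / 6 + 1)).filter
      (fun m ↦ ∀ p ∈ L, ¬ p ∣ m)).card : ℕ) : ℝ) * Real.log (2 * ((N : ℝ) ^ 3 + 1)) ≤ ε / 2 * N * u := by
    calc _ ≤ (ε / 8 * N) * (4 * u) :=
          mul_le_mul hcount hlogG (Real.log_nonneg (by linarith [pow_nonneg hNpos.le 3])) (by positivity)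
      _ = ε / 2 * N * u := by ring
  have hNu : 0 < (N : ℝ) * u := mul_pos hNpos hupos
  calc Real.log (D.modularDegree : ℝ) ≤ _ := hmain
    _ ≤ ε / 4 * N * u + ε / 2 * N * u := add_le_add hterm1 hterm2
    _ = (3 * ε / 4) * (N * u) := by ring
    _ < ε * (N * u) := mul_lt_mul_of_pos_right (by linarith) hNu
    _ = ε * N * Real.log N := by rw [hu]; ring

/-- **Thm. 7.2, asymptotic clause, as consumed by Thm. 7.5** (`hδ` of
`pasten_thm_7_5_of_modularity_of_optimalDegreeBound`): `log δ_{1,N} < (1/24 + ε) N log N` for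
`N ≫_ε 1` — unconditionally (`exists_log_modularDegree_lt` with `ε`, and `0 ≤ (1/24) N log N`).
[cite: PastenShimura2024, Thm. 7.2 (asymptotic clause), p. 26] -/
theorem exists_log_modularDegree_lt' :
    ∀ ε : ℝ, 0 < ε → ∃ N₁ : ℕ, ∀ (N : ℕ) [NeZero N] (W : WeierstrassCurve ℚ) [W.IsElliptic]
      (D : ModularParametrizationData W N),
      (∀ (W' : WeierstrassCurve ℚ) [W'.IsElliptic] (D' : ModularParametrizationData W' N),
          D'.f = D.f → D.modularDegree ≤ D'.modularDegree) →
        N₁ ≤ N → Real.log (D.modularDegree : ℝ) < (1 / 24 + ε) * (N : ℝ) * Real.log N := by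
  intro ε hε
  obtain ⟨N₁, hN₁⟩ := exists_log_modularDegree_lt hε
  refine ⟨N₁, fun N _ W _ D hmin hN ↦ (hN₁ N W D hmin hN).trans_le ?_⟩
  have h1 : 0 ≤ (N : ℝ) * Real.log N := mul_nonneg (Nat.cast_nonneg N) (Real.log_natCast_nonneg N)
  nlinarith

/-- **The minimal modular degree of a globally minimal curve is `e^{o(N log N)}`**, granted
modularity with integral Manin constant (`nonempty_modularParametrizationData`, for the existence of a
datum) and the Mazur–Kenku comparison (`PastenShimura2024_minimalDegree_le_163_mul`) — and no spectral
input: for every `ε > 0` there is `N₁` such that `log m(W, N_W) < ε N_W log N_W` for every globally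
minimal elliptic `W/ℚ` of conductor `N_W ≥ N₁` (`log_minModularDegree_le_of_class_bound` with
`exists_log_modularDegree_lt` at `ε/2`, and `log 163 < (ε/2) N log N`). This is the hypothesis `hdeg`
of `pasten_thm_7_5_of_modularity` with `ε` in place of `1/24 + ε`.
[cite: PastenShimura2024, §3 p. 13 and Thm. 7.2 (asymptotic clause), p. 26] -/
theorem exists_log_minModularDegree_lt (hmod : nonempty_modularParametrizationData)
    (h163 : PastenShimura2024_minimalDegree_le_163_mul) {ε : ℝ} (hε : 0 < ε) :
    ∃ N₁ : ℕ, ∀ (W : WeierstrassCurve ℚ) [W.IsElliptic] [W.IsGloballyMinimal]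
      [NeZero (W.conductorNorm ℤ)], N₁ ≤ W.conductorNorm ℤ →
        Real.log (minModularDegree W (W.conductorNorm ℤ) : ℝ) <
          ε * (W.conductorNorm ℤ : ℝ) * Real.log (W.conductorNorm ℤ) := by
  obtain ⟨N₁, hN₁⟩ := exists_log_modularDegree_lt (half_pos hε)
  obtain ⟨M, hM⟩ := exists_lt_mul_mul_log (half_pos hε) (Real.log 163)
  refine ⟨max N₁ M, fun W _ _ _ hN ↦ ?_⟩
  have hN₁N : N₁ ≤ W.conductorNorm ℤ := le_trans (le_max_left _ _) hN
  have hMN : M ≤ W.conductorNorm ℤ := le_trans (le_max_right _ _) hN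
  have hB := log_minModularDegree_le_of_class_bound h163 (hmod W)
    (B := ε / 2 * (W.conductorNorm ℤ : ℝ) * Real.log (W.conductorNorm ℤ))
    (fun W₀ _ D₀ hmin ↦ hN₁ (W.conductorNorm ℤ) W₀ D₀ hmin hN₁N)
  have h163' := hM (W.conductorNorm ℤ) hMN
  linarith

/-- The same from the Modularity Theorem "Version `a_p`" (`exists_isNewformOf`) and Mazur–Kenku:
`log m(W, N_W) < ε N_W log N_W` for every globally minimal elliptic `W/ℚ` of conductor
`N_W ≫_ε 1` (`nonempty_modularParametrizationData_of_modularity` with the discharged leaf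
`IsNewformOf.exists_maninConstant_modularDegree_holds`).
[cite: PastenShimura2024, §3 p. 13 and Thm. 7.2 (asymptotic clause), p. 26] [cite: BCDTJAMS2001, Thm. A] -/
theorem exists_log_minModularDegree_lt_of_exists_isNewformOf (h₁ : exists_isNewformOf)
    (h163 : PastenShimura2024_minimalDegree_le_163_mul) {ε : ℝ} (hε : 0 < ε) :
    ∃ N₁ : ℕ, ∀ (W : WeierstrassCurve ℚ) [W.IsElliptic] [W.IsGloballyMinimal]
      [NeZero (W.conductorNorm ℤ)], N₁ ≤ W.conductorNorm ℤ →
        Real.log (minModularDegree W (W.conductorNorm ℤ) : ℝ) <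
          ε * (W.conductorNorm ℤ : ℝ) * Real.log (W.conductorNorm ℤ) :=
  exists_log_minModularDegree_lt
    (nonempty_modularParametrizationData_of_modularity h₁
      IsNewformOf.exists_maninConstant_modularDegree_holds) h163 hε

end Pasten2024

/-! ### Thm. 7.5 from modularity and Mazur–Kenku — two named facts -/

/-- **Pasten, Thm. 7.5 from modularity with integral Manin constant and the Mazur–Kenku comparison —
nothing else.** Inputs: the named facts `nonempty_modularParametrizationData` and
`PastenShimura2024_minimalDegree_le_163_mul`; the asymptotic clause of Thm. 7.2 is the unconditional
`Pasten2024.exists_log_modularDegree_lt'` (Thm. 5.5, Prop. 7.1, the `q`-expansion injection, Brun's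
pure sieve and Mertens' theorems — all theorems of the tree; no multiplicity bound, no trace formula,
no Deligne, no Rankin–Selberg).
[cite: PastenShimura2024, Theorem 7.5 (proof, §7.4 p. 27) with Thm 7.2 (p. 26) and §3 p. 13] -/
theorem pasten_thm_7_5_of_modularity_mazurKenku
    (hmod : nonempty_modularParametrizationData)
    (h163 : PastenShimura2024_minimalDegree_le_163_mul) :
    pasten_thm_7_5 :=
  pasten_thm_7_5_of_modularity_of_optimalDegreeBound hmod h163
    fun _ hε ↦ Pasten2024.exists_log_modularDegree_lt' _ hε

/-- **Pasten, Thm. 7.5 from TWO named facts of the tree**: the Modularity Theorem "Version `a_p`"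
(`exists_isNewformOf`) and the Mazur–Kenku comparison (`PastenShimura2024_minimalDegree_le_163_mul`,
Mazur 1978 + Kenku, with Edixhoven's integrality inside). This is the smallest set of named inputs
reached in the tree for the unconditional clause of Thm. 7.5: both are inputs of the printed proof
(§3, (EqFrey) and the Mazur–Kenku step `|h(A) − h(E)| < 3`), while the spectral input of the printed
proof of Thm. 7.2 (Murty's Lemma 11) is replaced by theorems of the tree.
[cite: PastenShimura2024, Theorem 7.5 (proof, §7.4 p. 27) with §3 p. 13 and Thm 7.2 (p. 26)]
[cite: BCDTJAMS2001, Thm. A] -/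
theorem pasten_thm_7_5_of_exists_isNewformOf_mazurKenku
    (h₁ : exists_isNewformOf)
    (h163 : PastenShimura2024_minimalDegree_le_163_mul) :
    pasten_thm_7_5 :=
  pasten_thm_7_5_of_modularity_mazurKenku
    (nonempty_modularParametrizationData_of_modularity h₁
      IsNewformOf.exists_maninConstant_modularDegree_holds) h163

/-- **Pasten, Thm. 7.5 from the printed inputs of §3 alone**: modularity "Version `a_p`"
(`exists_isNewformOf`), Mazur–Kenku (`mazurKenku_exists_cyclic_isogeny`) and the integrality of Manin
constants (`hInt`, Edixhoven 1991 Prop. 2, the hypothesis of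
`PastenShimura2024_minimalDegree_le_163_mul_of_mazurKenku`); the whole of §5–§7.2's spectral input
beyond Thm. 5.5 (Hasse–Weil/Deligne, Murty's Lemma 11) is dispensed with.
[cite: PastenShimura2024, Theorem 7.5 (proof, §7.4 p. 27) with §3 p. 13]
[cite: Mazur1978, Thm. 1] [cite: Kenku1982] [cite: EdixhovenManin1991, Prop. 2] -/
theorem pasten_thm_7_5_of_exists_isNewformOf_mazurKenku_edixhoven
    (h₁ : exists_isNewformOf)
    (hMK : mazurKenku_exists_cyclic_isogeny)
    (hInt : ∀ {N : ℕ} [NeZero N] {W' : WeierstrassCurve ℚ} [W'.IsElliptic] [W'.IsGloballyMinimal]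
      (D' : ModularParametrizationData W' N) (q : ℚ),
      (∀ z ∈ periodLattice D'.f, (q : ℂ) * z ∈ D'.L.lattice) → ∃ k : ℤ, (k : ℚ) = q) :
    pasten_thm_7_5 :=
  pasten_thm_7_5_of_exists_isNewformOf_mazurKenku h₁
    (PastenShimura2024_minimalDegree_le_163_mul_of_mazurKenku hMK hInt)

/-! ### Beyond the printed constant: `log |Δ_E| = o(N_E log N_E)` from modularity and Mazur–Kenku -/

/-- **`log |Δ_E| < ε N_E log N_E` for `N_E ≫_ε 1`, granted modularity with integral Manin constant
and the Mazur–Kenku comparison** — a sharpening, obtained in the tree, of the unconditional clause of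
Pasten's Thm. 7.5 (printed: `(1/4 + ε) N log N`, the `1/4` coming from `6 · (1/24)` in Thm. 7.2 via
Murty's Lemma 11): the §7.4 deduction `log Δ_E ≤ 6 log δ + 124` (§3 (3.1)–(3.2), the tree's
`Pasten2024.log_minimalDiscriminantNorm_le_of_modularity'`) fed with
`log m(W, N_W) < (ε/12) N_W log N_W` (`Pasten2024.exists_log_minModularDegree_lt`, the sieve route of
this file) after passing to a global minimal model (`hasGlobalMinimalModel_rat_holds`; `N_E` and
`|Δ_min|` are invariant). The implicit threshold is effective but not tracked. (The argument gives
`log |Δ_E| ≪ N_E log N_E / log log N_E`; no claim beyond what is proved here is made about the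
literature.) [cite: PastenShimura2024, Theorem 7.5 (proof, §7.4 p. 27) with §3 (3.1)–(3.2) p. 13] -/
theorem exists_log_minimalDiscriminantNorm_lt_of_modularity_mazurKenku
    (hmod : nonempty_modularParametrizationData)
    (h163 : PastenShimura2024_minimalDegree_le_163_mul) :
    ∀ ε : ℝ, 0 < ε → ∃ N₀ : ℕ, ∀ (W : WeierstrassCurve ℚ) [W.IsElliptic], N₀ ≤ W.conductorNorm ℤ →
      Real.log (W.minimalDiscriminantNorm ℤ) <
        ε * (W.conductorNorm ℤ : ℝ) * Real.log (W.conductorNorm ℤ) := by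
  intro ε hε
  obtain ⟨N₁, hN₁⟩ := Pasten2024.exists_log_minModularDegree_lt hmod h163
    (show (0 : ℝ) < ε / 12 by positivity)
  obtain ⟨M, hM⟩ := Pasten2024.exists_lt_mul_mul_log (half_pos hε) 124
  refine ⟨max N₁ M, fun W _ hNW ↦ ?_⟩
  -- pass to a global minimal model `C • W`
  obtain ⟨C, hC⟩ := _root_.WeierstrassCurve.hasGlobalMinimalModel_rat_holds W
  haveI := hC
  have hN : (C • W).conductorNorm ℤ = W.conductorNorm ℤ :=
    _root_.WeierstrassCurve.conductorNorm_smul_rat W C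
  have hΔ : (C • W).minimalDiscriminantNorm ℤ = W.minimalDiscriminantNorm ℤ :=
    _root_.WeierstrassCurve.minimalDiscriminantNorm_smul_rat W C
  haveI : NeZero ((C • W).conductorNorm ℤ) :=
    ⟨(_root_.WeierstrassCurve.conductorNorm_pos_holds (C • W)).ne'⟩
  have h1 := Pasten2024.log_minimalDiscriminantNorm_le_of_modularity' hmod (C • W)
  have h2 := hN₁ (C • W) (by rw [hN]; exact le_trans (le_max_left _ _) hNW)
  have h3 := hM ((C • W).conductorNorm ℤ) (by rw [hN]; exact le_trans (le_max_right _ _) hNW)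
  have key : Real.log ((C • W).minimalDiscriminantNorm ℤ : ℝ) <
      ε * ((C • W).conductorNorm ℤ : ℝ) * Real.log ((C • W).conductorNorm ℤ) := by
    linarith
  rw [hΔ, hN] at key
  exact key

/-- **`log |Δ_E| < ε N_E log N_E` for `N_E ≫_ε 1` from TWO named facts of the tree**: the Modularity
Theorem "Version `a_p`" (`exists_isNewformOf`) and the Mazur–Kenku comparison
(`PastenShimura2024_minimalDegree_le_163_mul`) — the same inputs as
`pasten_thm_7_5_of_exists_isNewformOf_mazurKenku`, with the conclusion of Thm. 7.5 sharpened from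
`(1/4 + ε)` to `ε` (`exists_log_minimalDiscriminantNorm_lt_of_modularity_mazurKenku` with
`nonempty_modularParametrizationData_of_modularity`).
[cite: PastenShimura2024, Theorem 7.5 (proof, §7.4 p. 27) with §3 p. 13] [cite: BCDTJAMS2001, Thm. A] -/
theorem exists_log_minimalDiscriminantNorm_lt_of_exists_isNewformOf_mazurKenku
    (h₁ : exists_isNewformOf)
    (h163 : PastenShimura2024_minimalDegree_le_163_mul) :
    ∀ ε : ℝ, 0 < ε → ∃ N₀ : ℕ, ∀ (W : WeierstrassCurve ℚ) [W.IsElliptic], N₀ ≤ W.conductorNorm ℤ →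
      Real.log (W.minimalDiscriminantNorm ℤ) <
        ε * (W.conductorNorm ℤ : ℝ) * Real.log (W.conductorNorm ℤ) :=
  exists_log_minimalDiscriminantNorm_lt_of_modularity_mazurKenku
    (nonempty_modularParametrizationData_of_modularity h₁
      IsNewformOf.exists_maninConstant_modularDegree_holds) h163

end Literature.NumberTheory.EllipticCurves

end
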